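import Literature.MathematicalPhysics.QuantumFieldTheory.Balaban1983to89.B3Op116LeibnizRows
import Literature.MathematicalPhysics.QuantumFieldTheory.Balaban1983to89.B3Op116MajorantStep

/-!
# Bałaban, *(Higgs)₂,₃ quantum fields in a finite volume III. Renormalization* [B3] — THE KERNEL OF THE OPERATOR (1.16) p. 414 AND
ITS COVARIANT DERIVATIVE IN THE ROW VARIABLE ARE UNIFORMLY BOUNDED AND EXPONENTIALLY DECAYING ON THE TORUS, for all `(n, n′)` with
`n + n′ + 2 > d` (value) resp. `n + n′ + 1 > d` (derivative) — FILE 4β₂ of the cell's programme for the analytic half of (1.16): the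
induction over the `n + n′` factors `V_k(Ã,B̃)` in the (2.6)/(2.10) majorant currency

statement-level skeleton of published theorems with citation tags; proofs where landed; nothing here is a claim about the Yang–Mills mass gap

T. Bałaban, Commun. Math. Phys. **88** (1983) 411–445 [cite: Balaban1983Higgs3]; part I, Commun. Math. Phys. **85** (1982) 603–636
[cite: Balaban1982Higgs1].  PDFs held: `paper:balaban1983-higgs-2-3-quantum-fields-finite-volume` (journal page = PDF page + 410;
p. 414 = `p0004.txt`, p. 424 = `p0014.txt`, p. 426 = `p0016.txt`).

CITATION HEADER (lean-in-tree rule).  Cell `lit-balaban` (HOME `run/shared/lean/pub/lit-balaban/`), proof seat **p35** gen 22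
(unit `lit-balaban-p35`); TAKING line HOME/STATUS 2026-08-23T05:03:06Z; design `lit-balaban-p35/DESIGN-FILE4.md` §9(c), master design
`lit-balaban-r14/DESIGN-B3-116-analytic.md` §2 («ORDER COUNT»), §4.  SKELETON rows **B3.Eq1.16 (analytic half)** / **B3.Eq2.5** (fold
owner r15) — LOCATED MEMBERS, no head claim; decl of record `B3Sect2StatementsPart2.ScaledKernels.Ineq25At` (r15) whose binders `hV`,
`hDv` (p40's `B3Ineq25Op116Smooth.ineq25At_op116_smooth_torus_of_bounds`) these theorems feed.  Programme files: FILE P `B3Op116Pieces`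
(p40 ✓), FILE E `B3Op116ScaleChains` (r14 ✓) + `B3Op116MajorantConvolution` (p33 ✓), FILE 3(a) `B3Op116SourceForm` (r14 ✓), FILE 3(b)
`B3Op116KernelRegularTorus` (r14 ✓: the value clause at `n = n′ = 1` with the `L²` ninth chain, `col`/`dcol` dictionary), FILE 4α
`B3Op116LeibnizRows` (p35 ✓: THEOREM A′, the rows without `D G D^*`), FILE 4β₁ `B3Op116MajorantStep` (p35 ✓: `row_step_le`), THIS FILE =
FILE 4β₂, FILE 5 `B3Ineq25Op116Smooth` (p40 ✓ 5(a)).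
USED BY NAME, never restated: p40's `B3Eq116TwoSidedExpansion.op116`, r14's `B3Op116SourceForm.{srcV, avgSrc, op116_zero_zero_apply,
op116_succ_left_apply, op116_succ_right_apply}`, `B3Op116KernelRegularTorus.{col, dcol, col_le, dcol_le, dcol_le_add_split, col_nonneg,
dcol_nonneg, norm_mapE_avgSrc_le_block, norm_G_cb_le_col, norm_covDeriv_G_cb_le_dcol}`, r15's carrier predicate
`B3Sect2StatementsPart2.ScaledKernels.Ineq210` on r14's `B3Ineq210RegularRegion.regRegionKernels` (discharged on the torus by
`B3Ineq210RegularRegion.ineq210_regularRegion_univ_small`, not re-proved here), p35's `B3Op116LeibnizRows.{norm_G_srcV_apply_le_leibniz,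
norm_covDeriv_G_srcV_le_leibniz}`, `B3Op116MajorantStep.{maj, stepC, row_step_le, …}`, p33's `B3Op116MajorantConvolution.majorant_le_top`.

## What is printed

[B3] p. 414 [PDF 4] (verbatim): *"in the last term of this expansion, equal to [G_k(Ω,B̃)V_k(Ã,B̃)]^n G_k(Ω,Ã+B̃)[V_k(Ã,B̃)G_k(Ω,B̃)]^{n′},
(1.16) we have the propagator G_k(Ω,Ã+B̃). … for n, n′ sufficiently large, a kernel of the operator (1.16) is a sufficiently regular
function of both variables. More exactly the Hölder norms of the covariant derivatives of this kernel, the norms defined for example in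
the inequalities (I.2.24) and (I.2.25) of Proposition I.2.1, are exponentially decaying with the distance of the arguments and are
uniformly bounded by O(1)(e(L^kε)^{1−α})^{n+n′}, where α > 0 but can be arbitrarily small. This estimate follows easily from the
properties of the propagators G_k(Ω, A) proved in the next paper."*  [B3] p. 426 (2.10) [PDF 16]: *"|G^η_{(j)}(Ω, B̃; x, x′)| ≤
O(1)(L^jη)^{−d+2}e^{−δ₁(L^jη)^{−1}|x−x′|}, (2.10) and if the propagator is differentiated, then for each differentiation, there is an
additional factor (L^jη)^{−1} on the right side."*

## What this file proves, and how

§1 THE KERNEL DICTIONARY in the currency `𝔪` of FILE 4β₁: `κ_X(x,y) ≤ 𝔪_k(ε^dC,2;δ₁)(x,y)` (r14's `col_le`), and the `D^ε_B`-columns of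
BOTH propagators `κ^D_{B,X}(b,y) ≤ 𝔪_k(ε^dC(1 + e|e|s·L^kε),1;δ₁)(b₋,y)` for `X = B` (`dcol_le`) and `X = A + B` (`dcol_le_add_split`: the
split `D_B = D_{A+B} − M` costs `|e|s·κ_{A+B}`, one exponent bought back with `L^kε`).
§2 **THE STEP ON FIELDS** (`step_state`): if `‖w(y)‖ ≤ 𝔪_k(c_v, 2+J; δ)(y,x′)` and `‖(D^ε_Bw)(b)‖ ≤ 𝔪_k(c_d, 1+J; δ)(b₋,x′)`, then for
`X ∈ {B, A+B}` the field `G_k(T,X)V_k(A,B)w` satisfies the same with `J + 1`, rate `δ/(4L)` and the constants `stepC(2,…)`, `stepC(1,…)` —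
FILE 4α's Leibniz rows (value: `κ_X`, exponent 2; derivative: `κ^D_{B,X}`, exponent 1) + r14's block form of the averaging sources + FILE
4β₁'s `row_step_le`.  §3 **THE INDUCTION** (`state_op116`): with `(rateAt, cvAt, cdAt)(J)` the explicit recursion `seqC` from an
ARBITRARY initial triple `(δ₀, cv₀, cd₀)` (so that other seeds — the dipole seed of FILE 4M — run through the same induction), for every
source `ψ` whose two propagator images `G_k(T,B)ψ`, `G_k(T,A+B)ψ` are in the state `J`, the field `(1.16)_{n,n′}ψ` is in the state
`J + n + n′` (induction on `n′` through r14's `op116_succ_right_apply`, inside on `n` through `op116_succ_left_apply`, base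
`op116_zero_zero_apply`).  §3b the unit sources `e_{(x′,i′)}` are in the state `0` of the triple `(δ₁, ε^dC, ε^dC(1+e|e|sL^kε))`
(`base_state`: `col_le`, §1; `state_op116_cb`).
§4 **THE THEOREMS** (torus `Ω = T_ε`, `m² > 0`, `a > 0`, `1 ≤ k ≤ K`, `L ≥ 2`, the (2.10) bounds `Ineq210 δ₁ C` of `G_k(T,B)` and
`G_k(T,A+B)`, `0 < δ₁ ≤ 1`, `sup_b|A_b| ≤ s`, `A` regular with `δ_A`): for ALL `n, n′` and `M = n + n′`,
**`kernel116_value_le`**: `M + 2 > d ⟹ ε^{−d}Σ_{i′}‖((1.16)_{n,n′}e_{(x′,i′)})(x)‖ ≤ valC(M)·(L^kε)^M·(L^kε)²((L^kε)^d)^{−1}·e^{−δ_M|x−x′|/L^k}`;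
**`kernel116_deriv_le`**: `M + 1 > d ⟹ ε^{−d}Σ_{i′}‖(D^ε_B(1.16)_{n,n′}e_{(x′,i′)})(⟨x,μ⟩)‖ ≤ derC(M)·(L^kε)^M·(L^kε)((L^kε)^d)^{−1}·e^{−δ_M|x−x′|/L^k}`
(p40's binder shapes `hV`/`hDv` with `t^{n+n′} ↦ (L^kε)^M` times the explicit constants `valC`, `derC`, which carry the matching powers of
`|e|s`, `ε⁻¹|e|δ_A`: every step multiplies by `|e|s·O(1) + ε⁻¹|e|δ_A·L^kε·O(1) + …`, so `valC(M)(L^kε)^M = O(1)^M(t + L^k|e|δ_A + …)^M`,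
`t = L^kε|e|s` — print's `O(1)(e(L^kε)…)^{n+n′}`; `δ_M = δ₁/(4L)^M`).  Thresholds = honest order counting (r14 DESIGN §2: each `G` is
worth `−2`, each `V` `+1`, each `D` `+1`; bounded iff order `< −d`): value `n + n′ ≥ 2`, derivative `n + n′ ≥ 3` in `d = 3`.

## Honest scope

Torus `Ω = T_ε` only (FILE 4α's Leibniz identity and the all-sites bookkeeping; boxes/regions: the (2.10) inputs exist R₀-free on cell
boxes — p35 gen 21 — but the Leibniz rearrangement has a boundary term there, not treated).  The (2.10) input enters as the HYPOTHESIS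
`Ineq210 δ₁ C` on r15's carrier for `B` and for `A + B` (both (I.2.23)-regular in print's regime; discharged on the torus by
`B3Ineq210RegularRegion.ineq210_regularRegion_univ_small`); the regularity `δ_A` of `A` is an explicit hypothesis (print's `Ã = a_kG_kQ_k^*A′`
is a smooth background; `δ_A ≤ δ_B + δ_{A+B}`, FILE 4α `reg_of_reg_add`) — r14's `kernel116_one_one_unif_le` (value, `n = n′ = 1`) uses
instead the Cor. 2.3 threshold and no `δ_A`: two located members of the same sentence.  NOT here: the Hölder clause (FILE 4γ: the same
induction with the (2.11) members as outer kernels, exponent `1 − α`), the dipole-source / mixed clauses (FILE 4M: need one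
Calderón–Zygmund cancellation, DESIGN-FILE4 §9(d)), the simplification of `valC`, `derC` to `C^M·(coupling)^M` (cosmetic; the recursion
`seqC` is explicit), and r15's `Ineq25At` itself (p40, FILE 5(b)).  Concrete `def`s (`kap4`, `cK1`, `seqC`, `rateAt`, `cvAt`, `cdAt`,
`valC`, `derC`); no `def … : Prop`, no new named fact; axioms standard.  Value = located engine of a by-reference step of B3, NOT summit
progress.
-/

noncomputable section

open scoped BigOperators

namespace Literature.MathematicalPhysics.QuantumFieldTheory.Balaban1983to89.B3Op116DKernelRegularTorus

open HiggsLattice (ChargeData ScalarField covDeriv)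
open HiggsCovariance (propagatorK E)
open HiggsAveraging (blockK blockIter)
open B1Eq230FluctCov (Ix cb)
open B1Ineq234Concrete (nCol)
open B3Ineq210RegularRegion (regRegionKernels)
open B3Op116SourceForm (srcV avgSrc op116_zero_zero_apply op116_succ_left_apply op116_succ_right_apply)
open B3Op116KernelRegularTorus (col dcol col_le dcol_le dcol_le_add_split col_nonneg dcol_nonneg norm_mapE_avgSrc_le_block
  norm_G_cb_le_col norm_covDeriv_G_cb_le_dcol)
open B3Op116LeibnizRows (norm_G_srcV_apply_le_leibniz norm_covDeriv_G_srcV_le_leibniz)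
open B3Op116MajorantStep (maj maj_nonneg maj_rate_mono maj_const_mono maj_add mul_maj maj_shift_left maj_exponent_reduce stepC
  stepC_nonneg row_step_le)
open B3Op116MajorantConvolution (majorant_le_top)
open B3Eq116TwoSidedExpansion (op116)

variable {P : HiggsLattice.Params} {N : ℕ}

/-! ## §1 The kernel dictionary in the currency `𝔪` -/

section Dictionary

variable {C : ChargeData N} {A B X : HiggsLattice.VecField P 0} {msq a : ℝ} {k K₀ : ℕ} {hL1 : 1 < P.L} {δ₁ Cst : ℝ}

/-- `κ_X(x,y) ≤ 𝔪_k(ε^dC, 2; δ₁)(x,y)` (r14's `col_le`). [cite: Balaban1983Higgs3, (2.6) p.424, (2.10) p.426] -/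
theorem col_le_maj (h210 : (regRegionKernels hL1 C Finset.univ X msq a k K₀).Ineq210 δ₁ Cst) (hmsq : 0 < msq) (ha : 0 < a)
    (hk : 1 ≤ k) (hkK : k ≤ P.K) (x y : HiggsLattice.Site P 0) :
    col C msq a k X x y ≤ maj P k (P.mesh 0 ^ P.d * Cst) 2 δ₁ x y :=
  col_le h210 hmsq ha hk hkK x y

/-- `κ^D_{X,X}(b,y) ≤ 𝔪_k(ε^dC, 1; δ₁)(b₋,y)` (r14's `dcol_le`). [cite: Balaban1983Higgs3, (2.6) p.424, (2.10) p.426] -/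
theorem dcol_self_le_maj (h210 : (regRegionKernels hL1 C Finset.univ X msq a k K₀).Ineq210 δ₁ Cst) (hmsq : 0 < msq) (ha : 0 < a)
    (hk : 1 ≤ k) (hkK : k ≤ P.K) (b : HiggsLattice.PBond P 0) (y : HiggsLattice.Site P 0) :
    dcol C msq a k X X b y ≤ maj P k (P.mesh 0 ^ P.d * Cst) 1 δ₁ b.src y :=
  dcol_le h210 hmsq ha hk hkK b y

end Dictionary

section DictionaryConst

/-- the common constant of the `D^ε_B`-columns of `G_k(T,B)` and `G_k(T,A+B)`: `ε^dC(1 + e|e|s·L^kε)`. [cite: Balaban1983Higgs3, (2.10) p.426] -/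
def cK1 (P : HiggsLattice.Params) {N : ℕ} (C : ChargeData N) (k : ℕ) (Cst s : ℝ) : ℝ :=
  P.mesh 0 ^ P.d * Cst * (1 + Real.exp 1 * (|C.e| * s) * P.mesh k)

/-- `ε^dC ≤ cK1` and `0 ≤ cK1` (`C ≥ 0`, `s ≥ 0`). [cite: Balaban1983Higgs3, (2.10) p.426] -/
theorem cK1_ge {C : ChargeData N} {k : ℕ} {Cst : ℝ} (hCst : 0 ≤ Cst) {s : ℝ} (hs : 0 ≤ s) :
    P.mesh 0 ^ P.d * Cst ≤ cK1 P C k Cst s ∧ 0 ≤ cK1 P C k Cst s := by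
  have hc : 0 ≤ P.mesh 0 ^ P.d * Cst := mul_nonneg (pow_nonneg (P.mesh_pos 0).le _) hCst
  have hp : 0 ≤ Real.exp 1 * (|C.e| * s) * P.mesh k := by
    have := P.mesh_pos k; have := Real.exp_nonneg (1:ℝ); positivity
  unfold cK1
  constructor
  · nlinarith
  · exact mul_nonneg hc (by linarith)

end DictionaryConst

section Dictionary2

variable {C : ChargeData N} {A B X : HiggsLattice.VecField P 0} {msq a : ℝ} {k K₀ : ℕ} {hL1 : 1 < P.L} {δ₁ Cst : ℝ}

/-- **`κ^D_{B,A+B}(b,y) ≤ 𝔪_k(ε^dC(1 + e|e|s·L^kε), 1; δ₁)(b₋,y)`**: the split `D^ε_B = D^ε_{A+B} − M` (r14's `dcol_le_add_split`), the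
column `κ_{A+B}(b₊,y)` shifted to `b₋` (factor `e`) and brought from exponent 2 to exponent 1 with one `L^kε`.
[cite: Balaban1982Higgs1, (3.14) p.614] [cite: Balaban1983Higgs3, (2.6) p.424, (2.10) p.426] -/
theorem dcol_add_le_maj (h210 : (regRegionKernels hL1 C Finset.univ (A + B) msq a k K₀).Ineq210 δ₁ Cst) (hmsq : 0 < msq) (ha : 0 < a)
    (hk : 1 ≤ k) (hkK : k ≤ P.K) (hδ₁ : 0 < δ₁) (hδ₁1 : δ₁ ≤ 1) (hCst : 0 ≤ Cst) {s : ℝ} (hs : 0 ≤ s)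
    (hA : ∀ b : HiggsLattice.PBond P 0, |A b| ≤ s) (b : HiggsLattice.PBond P 0) (y : HiggsLattice.Site P 0) :
    dcol C msq a k B (A + B) b y ≤ maj P k (cK1 P C k Cst s) 1 δ₁ b.src y := by
  have hc : 0 ≤ P.mesh 0 ^ P.d * Cst := mul_nonneg (pow_nonneg (P.mesh_pos 0).le _) hCst
  have hes : 0 ≤ |C.e| * s := mul_nonneg (abs_nonneg _) hs
  refine (dcol_le_add_split (C := C) (msq := msq) (a := a) (k := k) A B (hA b) y).trans ?_
  have h1 : dcol C msq a k (A + B) (A + B) b y ≤ maj P k (P.mesh 0 ^ P.d * Cst) 1 δ₁ b.src y := dcol_le h210 hmsq ha hk hkK b y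
  have h2 : col C msq a k (A + B) b.tgt y ≤ maj P k (Real.exp 1 * (P.mesh 0 ^ P.d * Cst) * P.mesh k) 1 δ₁ b.src y := by
    refine ((col_le h210 hmsq ha hk hkK b.tgt y).trans (maj_shift_left hδ₁ hδ₁1 hc b.src y b.dir)).trans ?_
    have h := maj_exponent_reduce (P := P) (k := k) (a := 2) (δ := δ₁) (mul_nonneg (Real.exp_nonneg 1) hc) b.src y
    rw [show (2 : ℝ) - 1 = 1 by norm_num] at h
    exact h
  refine (add_le_add h1 (mul_le_mul_of_nonneg_left h2 hes)).trans (le_of_eq ?_)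
  rw [mul_maj, maj_add, cK1]
  ring_nf

/-- `κ^D_{B,B}(b,y) ≤ 𝔪_k(cK1, 1; δ₁)(b₋,y)` (the weaker common constant). [cite: Balaban1983Higgs3, (2.10) p.426] -/
theorem dcol_B_le_maj (h210 : (regRegionKernels hL1 C Finset.univ B msq a k K₀).Ineq210 δ₁ Cst) (hmsq : 0 < msq) (ha : 0 < a)
    (hk : 1 ≤ k) (hkK : k ≤ P.K) (hCst : 0 ≤ Cst) {s : ℝ} (hs : 0 ≤ s) (b : HiggsLattice.PBond P 0) (y : HiggsLattice.Site P 0) :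
    dcol C msq a k B B b y ≤ maj P k (cK1 P C k Cst s) 1 δ₁ b.src y :=
  (dcol_le h210 hmsq ha hk hkK b y).trans (maj_const_mono (cK1_ge (P := P) (C := C) (k := k) hCst hs).1 b.src y)

end Dictionary2

/-! ## §2 The step on fields: `w ↦ G_k(T,X)V_k(A,B)w` preserves the majorant state and raises the index -/

section Step

/-- the coefficient of the averaging pairing: `κ₄ = |a_k|(L^kε)^{−2}·m(2+m)`, `m = |e|sεd(L^k−1)` (p40's `norm_fTwo_apply_le`).
[cite: Balaban1982Higgs1, (3.15)–(3.16) pp.614–615] -/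
def kap4 (P : HiggsLattice.Params) {N : ℕ} (C : ChargeData N) (k : ℕ) (a s : ℝ) : ℝ :=
  |B1.aSeq a P.L k| * (P.mesh k)⁻¹ ^ 2 *
    ((|C.e| * s * P.mesh 0 * (P.d * ((P.L : ℝ) ^ k - 1))) * (2 + |C.e| * s * P.mesh 0 * (P.d * ((P.L : ℝ) ^ k - 1))))

/-- `κ₄ ≥ 0` (`s ≥ 0`, `L ≥ 1`). [cite: Balaban1982Higgs1, (3.15) p.614] -/
theorem kap4_nonneg {C : ChargeData N} {k : ℕ} {a s : ℝ} (hs : 0 ≤ s) : 0 ≤ kap4 P C k a s := by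
  have hL1 : (1 : ℝ) ≤ (P.L : ℝ) ^ k := one_le_pow₀ (by exact_mod_cast P.hL)
  have h0 : (0 : ℝ) ≤ (P.L : ℝ) ^ k - 1 := by linarith
  have := P.mesh_pos 0
  have := P.mesh_pos k
  unfold kap4
  positivity

variable {C : ChargeData N} {A B X : HiggsLattice.VecField P 0} {msq a : ℝ} {k : ℕ} {δ₁ Cst s δA : ℝ}

/-- **THE STEP ON FIELDS.**  On the torus, for `X` with `κ_X ≤ 𝔪_k(c_{K2},2;δ₁)`, `κ^D_{B,X} ≤ 𝔪_k(c_{K1},1;δ₁)(b₋,·)`, `sup_b|A_b| ≤ s`, `A`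
regular with `δ_A`, `1 ≤ k ≤ K`: if `‖w(y)‖ ≤ 𝔪_k(c_v,a_v;δ)(y,x′)` and `‖(D^ε_Bw)(b)‖ ≤ 𝔪_k(c_d,a_v−1;δ)(b₋,x′)` (`a_v > 1`, `0 < δ ≤ δ₁ ≤ 1`),
then `w⁺ = G_k(T,X)V_k(A,B)w` satisfies `‖w⁺(y)‖ ≤ 𝔪_k(stepC(2,…), a_v+1; δ/(4L))(y,x′)` and `‖(D^ε_Bw⁺)(b₀)‖ ≤ 𝔪_k(stepC(1,…), a_v; δ/(4L))(b₀₋,x′)`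
— FILE 4α's Leibniz rows, r14's block form of the averaging sources, FILE 4β₁'s `row_step_le`. [cite: Balaban1983Higgs3, (1.16) p.414, (2.10) p.426] [cite: Balaban1982Higgs1, (3.16) p.615] -/
theorem step_fields (hL : 1 < P.L) (hk : 1 ≤ k) (hkK : k ≤ P.K) {cK2 cK1 : ℝ} (hcK2 : 0 ≤ cK2) (hcK1 : 0 ≤ cK1)
    (hcolX : ∀ x y, col C msq a k X x y ≤ maj P k cK2 2 δ₁ x y)
    (hdcolX : ∀ b y, dcol C msq a k B X b y ≤ maj P k cK1 1 δ₁ b.src y)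
    (hδ₁1 : δ₁ ≤ 1) (hs : 0 ≤ s) (hA : ∀ b : HiggsLattice.PBond P 0, |A b| ≤ s) (hδA : 0 ≤ δA)
    (hregA : ∀ (z : HiggsLattice.Site P 0) (μ ν : Fin P.d), |A ⟨z.shift ν, μ⟩ - A ⟨z, μ⟩| ≤ δA)
    (i₀ : Ix N) (x' : HiggsLattice.Site P 0) {δ cv cd av : ℝ} (hδ : 0 < δ) (hδδ₁ : δ ≤ δ₁) (hav : 1 < av) (hcv : 0 ≤ cv) (hcd : 0 ≤ cd)
    (w : ScalarField P 0 N) (hV : ∀ y, ‖w y‖ ≤ maj P k cv av δ y x')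
    (hD : ∀ b, ‖covDeriv C B w b‖ ≤ maj P k cd (av - 1) δ b.src x') :
    (∀ y, ‖propagatorK C Finset.univ X msq a k (srcV C A B k Finset.univ a w) y‖
        ≤ maj P k (stepC P N k δ 2 av cK2 cv cd (|C.e| * s) ((P.mesh 0)⁻¹ * (|C.e| * δA)) ((|C.e| * s) ^ 2) (kap4 P C k a s))
            (2 + av - 1) (δ / 2 / P.L / 2) y x') ∧
    (∀ b₀, ‖covDeriv C B (propagatorK C Finset.univ X msq a k (srcV C A B k Finset.univ a w)) b₀‖
        ≤ maj P k (stepC P N k δ 1 av cK1 cv cd (|C.e| * s) ((P.mesh 0)⁻¹ * (|C.e| * δA)) ((|C.e| * s) ^ 2) (kap4 P C k a s))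
            (1 + av - 1) (δ / 2 / P.L / 2) b₀.src x') := by
  have hδ1 : δ ≤ 1 := hδδ₁.trans hδ₁1
  have hes : 0 ≤ |C.e| * s := mul_nonneg (abs_nonneg _) hs
  have hκ₂ : 0 ≤ (P.mesh 0)⁻¹ * (|C.e| * δA) := mul_nonneg (inv_nonneg.mpr (P.mesh_pos 0).le) (mul_nonneg (abs_nonneg _) hδA)
  have hκ₄ : 0 ≤ kap4 P C k a s := kap4_nonneg hs
  set m : ℝ := |C.e| * s * P.mesh 0 * (P.d * ((P.L : ℝ) ^ k - 1)) with hm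
  have hca : 0 ≤ |B1.aSeq a P.L k| * (P.mesh k)⁻¹ ^ 2 := by positivity
  set G : ScalarField P 0 N →ₗ[ℝ] ScalarField P 0 N := propagatorK C Finset.univ X msq a k with hG
  constructor
  · intro y
    -- the value row in Leibniz form
    have hrow := norm_G_srcV_apply_le_leibniz C A B X msq a k hA hregA w y
    -- the averaging source through the block form
    set T : ScalarField P 0 N →ₗ[ℝ] E N := (LinearMap.proj y : ScalarField P 0 N →ₗ[ℝ] E N) ∘ₗ G with hT
    have hT' : ∀ φ : ScalarField P 0 N, T φ = (G φ) y := fun φ => rfl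
    have havg := norm_mapE_avgSrc_le_block (C := C) (A := A) (B := B) (k := k) T hkK hs hA w
    have hcolT : ∀ z, ∑ i : Ix N, ‖T (cb P N 0 (z, i))‖ = col C msq a k X y z := fun z => by simp only [hT', hG]; rfl
    simp only [hcolT] at havg
    rw [hT'] at havg
    have hK : ∀ z, col C msq a k X y z ≤ maj P k cK2 2 δ y z := fun z => (hcolX y z).trans (maj_rate_mono hcK2 hδδ₁ y z)
    have hstep := row_step_le (N := N) hL hk hkK hδ hδ1 (by norm_num : (0:ℝ) < 2) hav hcK2 hcv hcd hes hκ₂ (sq_nonneg (|C.e| * s)) hκ₄ i₀ y x'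
      (fun z => col C msq a k X y z) (fun z => col_nonneg (C := C) (msq := msq) (a := a) (k := k) X y z) hK
      (fun z => ‖w z‖) (fun z => norm_nonneg _) hV (fun b => ‖covDeriv C B w b‖) (fun b => norm_nonneg _) hD
    refine hrow.trans (le_trans ?_ hstep)
    refine add_le_add le_rfl ?_
    -- |a_k|ℓ⁻² ‖(G avgSrc w)(y)‖ ≤ κ₄ Σ_z col(y,z) Blk_z‖w‖
    have h1 := mul_le_mul_of_nonneg_left havg hca
    refine h1.trans (le_of_eq ?_)
    rw [kap4, Finset.mul_sum, Finset.mul_sum]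
    exact Finset.sum_congr rfl fun z _ => by rw [← hm]; ring
  · intro b₀
    have hrow := norm_covDeriv_G_srcV_le_leibniz C A B X msq a k hA hregA w b₀
    set T : ScalarField P 0 N →ₗ[ℝ] E N := B3Op116SourceForm.covDerivAt C B b₀ ∘ₗ G with hT
    have hT' : ∀ φ : ScalarField P 0 N, T φ = covDeriv C B (G φ) b₀ := fun φ => rfl
    have havg := norm_mapE_avgSrc_le_block (C := C) (A := A) (B := B) (k := k) T hkK hs hA w
    have hcolT : ∀ z, ∑ i : Ix N, ‖T (cb P N 0 (z, i))‖ = dcol C msq a k B X b₀ z := fun z => by simp only [hT', hG]; rfl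
    simp only [hcolT] at havg
    rw [hT'] at havg
    have hK : ∀ z, dcol C msq a k B X b₀ z ≤ maj P k cK1 1 δ b₀.src z :=
      fun z => (hdcolX b₀ z).trans (maj_rate_mono hcK1 hδδ₁ b₀.src z)
    have hstep := row_step_le (N := N) hL hk hkK hδ hδ1 (by norm_num : (0:ℝ) < 1) hav hcK1 hcv hcd hes hκ₂ (sq_nonneg (|C.e| * s)) hκ₄ i₀
      b₀.src x' (fun z => dcol C msq a k B X b₀ z) (fun z => dcol_nonneg (C := C) (msq := msq) (a := a) (k := k) B X b₀ z) hK
      (fun z => ‖w z‖) (fun z => norm_nonneg _) hV (fun b => ‖covDeriv C B w b‖) (fun b => norm_nonneg _) hD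
    refine hrow.trans (le_trans ?_ hstep)
    refine add_le_add le_rfl ?_
    have h1 := mul_le_mul_of_nonneg_left havg hca
    refine h1.trans (le_of_eq ?_)
    rw [kap4, Finset.mul_sum, Finset.mul_sum]
    exact Finset.sum_congr rfl fun z _ => by rw [← hm]; ring

end Step

/-! ## §3 The induction over the `n + n′` factors `V_k` -/

section Induction

/-- **The explicit recursion of (rate, value constant, derivative constant)** along the factors of (1.16): an initial state
`(δ₀, cv₀, cd₀)` at `J = 0` (the unit sources: `(δ₁, ε^dC, ε^dC(1+e|e|sL^kε))`; FILE 4M's dipole seed: its own triple), then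
`(δ/(4L), stepC(2,2+J,…), stepC(1,2+J,…))`. [cite: Balaban1983Higgs3, (1.16) p.414, (2.10) p.426] -/
def seqC (P : HiggsLattice.Params) (N : ℕ) (C : ChargeData N) (k : ℕ) (a Cst s δA δ₀ cv₀ cd₀ : ℝ) : ℕ → ℝ × ℝ × ℝ
  | 0 => (δ₀, cv₀, cd₀)
  | J + 1 =>
    ((seqC P N C k a Cst s δA δ₀ cv₀ cd₀ J).1 / 2 / P.L / 2,
      stepC P N k (seqC P N C k a Cst s δA δ₀ cv₀ cd₀ J).1 2 (2 + (J : ℝ)) (P.mesh 0 ^ P.d * Cst)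
        (seqC P N C k a Cst s δA δ₀ cv₀ cd₀ J).2.1 (seqC P N C k a Cst s δA δ₀ cv₀ cd₀ J).2.2
        (|C.e| * s) ((P.mesh 0)⁻¹ * (|C.e| * δA)) ((|C.e| * s) ^ 2) (kap4 P C k a s),
      stepC P N k (seqC P N C k a Cst s δA δ₀ cv₀ cd₀ J).1 1 (2 + (J : ℝ)) (cK1 P C k Cst s)
        (seqC P N C k a Cst s δA δ₀ cv₀ cd₀ J).2.1 (seqC P N C k a Cst s δA δ₀ cv₀ cd₀ J).2.2
        (|C.e| * s) ((P.mesh 0)⁻¹ * (|C.e| * δA)) ((|C.e| * s) ^ 2) (kap4 P C k a s))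

/-- the rate after `J` factors: `δ_J = δ₁/(4L)^J`. [cite: Balaban1983Higgs3, (2.10) p.426] -/
def rateAt (P : HiggsLattice.Params) (N : ℕ) (C : ChargeData N) (k : ℕ) (a Cst s δA δ₀ cv₀ cd₀ : ℝ) (J : ℕ) : ℝ :=
  (seqC P N C k a Cst s δA δ₀ cv₀ cd₀ J).1

/-- the value constant after `J` factors. [cite: Balaban1983Higgs3, (1.16) p.414] -/
def cvAt (P : HiggsLattice.Params) (N : ℕ) (C : ChargeData N) (k : ℕ) (a Cst s δA δ₀ cv₀ cd₀ : ℝ) (J : ℕ) : ℝ :=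
  (seqC P N C k a Cst s δA δ₀ cv₀ cd₀ J).2.1

/-- the derivative constant after `J` factors. [cite: Balaban1983Higgs3, (1.16) p.414] -/
def cdAt (P : HiggsLattice.Params) (N : ℕ) (C : ChargeData N) (k : ℕ) (a Cst s δA δ₀ cv₀ cd₀ : ℝ) (J : ℕ) : ℝ :=
  (seqC P N C k a Cst s δA δ₀ cv₀ cd₀ J).2.2

variable {C : ChargeData N} {A B : HiggsLattice.VecField P 0} {msq a : ℝ} {k K₀ : ℕ} {hL1 : 1 < P.L} {δ₁ Cst s δA δ₀ cv₀ cd₀ : ℝ}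

/-- the recursion, unfolded one step. [cite: Balaban1983Higgs3, (1.16) p.414] -/
theorem seqC_succ (J : ℕ) :
    rateAt P N C k a Cst s δA δ₀ cv₀ cd₀ (J + 1) = rateAt P N C k a Cst s δA δ₀ cv₀ cd₀ J / 2 / P.L / 2 ∧
    cvAt P N C k a Cst s δA δ₀ cv₀ cd₀ (J + 1) = stepC P N k (rateAt P N C k a Cst s δA δ₀ cv₀ cd₀ J) 2 (2 + (J : ℝ)) (P.mesh 0 ^ P.d * Cst)
        (cvAt P N C k a Cst s δA δ₀ cv₀ cd₀ J) (cdAt P N C k a Cst s δA δ₀ cv₀ cd₀ J)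
        (|C.e| * s) ((P.mesh 0)⁻¹ * (|C.e| * δA)) ((|C.e| * s) ^ 2) (kap4 P C k a s) ∧
    cdAt P N C k a Cst s δA δ₀ cv₀ cd₀ (J + 1) = stepC P N k (rateAt P N C k a Cst s δA δ₀ cv₀ cd₀ J) 1 (2 + (J : ℝ)) (cK1 P C k Cst s)
        (cvAt P N C k a Cst s δA δ₀ cv₀ cd₀ J) (cdAt P N C k a Cst s δA δ₀ cv₀ cd₀ J)
        (|C.e| * s) ((P.mesh 0)⁻¹ * (|C.e| * δA)) ((|C.e| * s) ^ 2) (kap4 P C k a s) :=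
  ⟨rfl, rfl, rfl⟩

/-- the recursion at `J = 0`. [cite: Balaban1983Higgs3, (2.10) p.426] -/
theorem seqC_zero :
    rateAt P N C k a Cst s δA δ₀ cv₀ cd₀ 0 = δ₀ ∧ cvAt P N C k a Cst s δA δ₀ cv₀ cd₀ 0 = cv₀ ∧
    cdAt P N C k a Cst s δA δ₀ cv₀ cd₀ 0 = cd₀ :=
  ⟨rfl, rfl, rfl⟩

/-- positivity along the recursion: `0 < δ_J ≤ δ₁`, `0 ≤ cvAt J`, `0 ≤ cdAt J` (`0 < δ₀ ≤ δ₁`, `cv₀, cd₀, C, s, δ_A ≥ 0`, `L > 1`).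
[cite: Balaban1983Higgs3, (2.10) p.426] -/
theorem seqC_pos (hL : 1 < P.L) (hδ₀ : 0 < δ₀) (hδ₀1 : δ₀ ≤ δ₁) (hcv₀ : 0 ≤ cv₀) (hcd₀ : 0 ≤ cd₀)
    (hCst : 0 ≤ Cst) (hs : 0 ≤ s) (hδA : 0 ≤ δA) (J : ℕ) :
    0 < rateAt P N C k a Cst s δA δ₀ cv₀ cd₀ J ∧ rateAt P N C k a Cst s δA δ₀ cv₀ cd₀ J ≤ δ₁ ∧
    0 ≤ cvAt P N C k a Cst s δA δ₀ cv₀ cd₀ J ∧ 0 ≤ cdAt P N C k a Cst s δA δ₀ cv₀ cd₀ J := by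
  have hL1 : (1 : ℝ) < (P.L : ℝ) := by exact_mod_cast hL
  have hes : 0 ≤ |C.e| * s := mul_nonneg (abs_nonneg _) hs
  have hκ₂ : 0 ≤ (P.mesh 0)⁻¹ * (|C.e| * δA) := mul_nonneg (inv_nonneg.mpr (P.mesh_pos 0).le) (mul_nonneg (abs_nonneg _) hδA)
  have hκ₄ : 0 ≤ kap4 P C k a s := kap4_nonneg hs
  have hc : 0 ≤ P.mesh 0 ^ P.d * Cst := mul_nonneg (pow_nonneg (P.mesh_pos 0).le _) hCst
  obtain ⟨-, hcK1⟩ := cK1_ge (P := P) (C := C) (k := k) hCst hs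
  induction J with
  | zero => exact ⟨hδ₀, hδ₀1, hcv₀, hcd₀⟩
  | succ J ih =>
    obtain ⟨h1, h2, h3, h4⟩ := ih
    obtain ⟨e1, e2, e3⟩ := seqC_succ (P := P) (N := N) (C := C) (k := k) (a := a) (Cst := Cst) (s := s) (δA := δA) (δ₀ := δ₀) (cv₀ := cv₀) (cd₀ := cd₀) J
    have hJ : (1 : ℝ) < 2 + (J : ℝ) := by have := (Nat.cast_nonneg J : (0:ℝ) ≤ J); linarith
    refine ⟨?_, ?_, ?_, ?_⟩
    · rw [e1]; positivity
    · rw [e1]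
      calc rateAt P N C k a Cst s δA δ₀ cv₀ cd₀ J / 2 / P.L / 2 ≤ rateAt P N C k a Cst s δA δ₀ cv₀ cd₀ J := by
            rw [div_div, div_div, div_le_iff₀ (by positivity)]; nlinarith
        _ ≤ δ₁ := h2
    · rw [e2]; exact stepC_nonneg hL k h1 (by norm_num) hJ hc h3 h4 hes hκ₂ (sq_nonneg _) hκ₄
    · rw [e3]; exact stepC_nonneg hL k h1 (by norm_num) hJ hcK1 h3 h4 hes hκ₂ (sq_nonneg _) hκ₄

variable (hδ₁ : 0 < δ₁) (hδ₁1 : δ₁ ≤ 1) (hCst : 0 ≤ Cst)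
  (h210B : (regRegionKernels hL1 C Finset.univ B msq a k K₀).Ineq210 δ₁ Cst)
  (h210AB : (regRegionKernels hL1 C Finset.univ (A + B) msq a k K₀).Ineq210 δ₁ Cst)
  (hmsq : 0 < msq) (ha : 0 < a) (hk : 1 ≤ k) (hkK : k ≤ P.K) (i₀ : Ix N)
  (hs : 0 ≤ s) (hA : ∀ b : HiggsLattice.PBond P 0, |A b| ≤ s) (hδA : 0 ≤ δA)
  (hregA : ∀ (z : HiggsLattice.Site P 0) (μ ν : Fin P.d), |A ⟨z.shift ν, μ⟩ - A ⟨z, μ⟩| ≤ δA)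
  (hδ₀ : 0 < δ₀) (hδ₀1 : δ₀ ≤ δ₁) (hcv₀ : 0 ≤ cv₀) (hcd₀ : 0 ≤ cd₀)
  (x' : HiggsLattice.Site P 0)
include hδ₁ hδ₁1 hCst h210B h210AB hmsq ha hk hkK i₀ hs hA hδA hregA hδ₀ hδ₀1 hcv₀ hcd₀

/-- **THE STEP ON THE STATE**: if `w` is in the state `J` (values `𝔪_k(cvAt J, 2+J; δ_J)`, derivatives `𝔪_k(cdAt J, 1+J; δ_J)(b₋,·)`),
then `G_k(T,X)V_k(A,B)w` is in the state `J + 1` for `X = B` and for `X = A + B`. [cite: Balaban1983Higgs3, (1.16) p.414, (2.10) p.426] -/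
theorem step_state (J : ℕ) (w : ScalarField P 0 N)
    (hV : ∀ y, ‖w y‖ ≤ maj P k (cvAt P N C k a Cst s δA δ₀ cv₀ cd₀ J) (2 + (J : ℝ)) (rateAt P N C k a Cst s δA δ₀ cv₀ cd₀ J) y x')
    (hD : ∀ b, ‖covDeriv C B w b‖ ≤ maj P k (cdAt P N C k a Cst s δA δ₀ cv₀ cd₀ J) (1 + (J : ℝ)) (rateAt P N C k a Cst s δA δ₀ cv₀ cd₀ J) b.src x')
    (X : HiggsLattice.VecField P 0) (hX : X = B ∨ X = A + B) :
    (∀ y, ‖propagatorK C Finset.univ X msq a k (srcV C A B k Finset.univ a w) y‖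
        ≤ maj P k (cvAt P N C k a Cst s δA δ₀ cv₀ cd₀ (J + 1)) (2 + ((J + 1 : ℕ) : ℝ)) (rateAt P N C k a Cst s δA δ₀ cv₀ cd₀ (J + 1)) y x') ∧
    (∀ b₀, ‖covDeriv C B (propagatorK C Finset.univ X msq a k (srcV C A B k Finset.univ a w)) b₀‖
        ≤ maj P k (cdAt P N C k a Cst s δA δ₀ cv₀ cd₀ (J + 1)) (1 + ((J + 1 : ℕ) : ℝ)) (rateAt P N C k a Cst s δA δ₀ cv₀ cd₀ (J + 1)) b₀.src x') := by
  have hL : 1 < P.L := hL1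
  obtain ⟨hr0, hrδ, hcv0, hcd0⟩ := seqC_pos (P := P) (N := N) (C := C) (k := k) (a := a) (Cst := Cst) (s := s) (δA := δA) (δ₀ := δ₀) (cv₀ := cv₀) (cd₀ := cd₀) hL hδ₀ hδ₀1 hcv₀ hcd₀ hCst hs hδA J
  obtain ⟨e1, e2, e3⟩ := seqC_succ (P := P) (N := N) (C := C) (k := k) (a := a) (Cst := Cst) (s := s) (δA := δA) (δ₀ := δ₀) (cv₀ := cv₀) (cd₀ := cd₀) J
  have hc : 0 ≤ P.mesh 0 ^ P.d * Cst := mul_nonneg (pow_nonneg (P.mesh_pos 0).le _) hCst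
  obtain ⟨-, hcK1⟩ := cK1_ge (P := P) (C := C) (k := k) hCst hs
  have hJ : (1 : ℝ) < 2 + (J : ℝ) := by have := (Nat.cast_nonneg J : (0:ℝ) ≤ J); linarith
  have hD' : ∀ b, ‖covDeriv C B w b‖ ≤ maj P k (cdAt P N C k a Cst s δA δ₀ cv₀ cd₀ J) (2 + (J : ℝ) - 1) (rateAt P N C k a Cst s δA δ₀ cv₀ cd₀ J) b.src x' := by
    intro b; rw [show (2 : ℝ) + (J : ℝ) - 1 = 1 + (J : ℝ) by ring]; exact hD b
  -- kernel dictionary for X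
  have hcolX : ∀ x y, col C msq a k X x y ≤ maj P k (P.mesh 0 ^ P.d * Cst) 2 δ₁ x y := by
    rcases hX with rfl | rfl
    · exact fun x y => col_le_maj h210B hmsq ha hk hkK x y
    · exact fun x y => col_le_maj h210AB hmsq ha hk hkK x y
  have hdcolX : ∀ b y, dcol C msq a k B X b y ≤ maj P k (cK1 P C k Cst s) 1 δ₁ b.src y := by
    rcases hX with rfl | rfl
    · exact fun b y => dcol_B_le_maj h210B hmsq ha hk hkK hCst hs b y
    · exact fun b y => dcol_add_le_maj h210AB hmsq ha hk hkK hδ₁ hδ₁1 hCst hs hA b y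
  obtain ⟨hv, hd⟩ := step_fields (X := X) hL hk hkK hc hcK1 hcolX hdcolX hδ₁1 hs hA hδA hregA i₀ x' hr0 hrδ hJ hcv0 hcd0 w hV hD'
  have ev : (2 : ℝ) + (2 + (J : ℝ)) - 1 = 2 + ((J + 1 : ℕ) : ℝ) := by push_cast; ring
  have ed : (1 : ℝ) + (2 + (J : ℝ)) - 1 = 1 + ((J + 1 : ℕ) : ℝ) := by push_cast; ring
  constructor
  · intro y
    have h := hv y
    rw [ev, ← e1, ← e2] at h
    exact h
  · intro b₀
    have h := hd b₀
    rw [ed, ← e1, ← e3] at h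
    exact h

/-- **THE INDUCTION OVER THE FACTORS OF (1.16).**  If both propagator images `G_k(T,B)ψ`, `G_k(T,A+B)ψ` of a source `ψ` are in the state
`J`, then `(1.16)_{n,n′}ψ = [G_k(T,B)V_k]^nG_k(T,A+B)[V_kG_k(T,B)]^{n′}ψ` is in the state `J + (n + n′)` (induction on `n′` by r14's
`op116_succ_right_apply`, on `n` by `op116_succ_left_apply`, base `op116_zero_zero_apply`). [cite: Balaban1983Higgs3, (1.16) p.414, (2.10) p.426] -/
theorem state_op116 : ∀ (n' n J : ℕ) (ψ : ScalarField P 0 N),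
    (∀ X : HiggsLattice.VecField P 0, (X = B ∨ X = A + B) →
      (∀ y, ‖propagatorK C Finset.univ X msq a k ψ y‖
          ≤ maj P k (cvAt P N C k a Cst s δA δ₀ cv₀ cd₀ J) (2 + (J : ℝ)) (rateAt P N C k a Cst s δA δ₀ cv₀ cd₀ J) y x') ∧
      (∀ b₀, ‖covDeriv C B (propagatorK C Finset.univ X msq a k ψ) b₀‖
          ≤ maj P k (cdAt P N C k a Cst s δA δ₀ cv₀ cd₀ J) (1 + (J : ℝ)) (rateAt P N C k a Cst s δA δ₀ cv₀ cd₀ J) b₀.src x')) →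
    (∀ y, ‖op116 C Finset.univ A B msq a k n n' ψ y‖
        ≤ maj P k (cvAt P N C k a Cst s δA δ₀ cv₀ cd₀ (J + (n + n'))) (2 + ((J + (n + n') : ℕ) : ℝ))
            (rateAt P N C k a Cst s δA δ₀ cv₀ cd₀ (J + (n + n'))) y x') ∧
    (∀ b₀, ‖covDeriv C B (op116 C Finset.univ A B msq a k n n' ψ) b₀‖
        ≤ maj P k (cdAt P N C k a Cst s δA δ₀ cv₀ cd₀ (J + (n + n'))) (1 + ((J + (n + n') : ℕ) : ℝ))
            (rateAt P N C k a Cst s δA δ₀ cv₀ cd₀ (J + (n + n'))) b₀.src x') := by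
  intro n'
  induction n' with
  | zero =>
    intro n
    induction n with
    | zero =>
      intro J ψ hψ
      have h := hψ (A + B) (Or.inr rfl)
      simp only [Nat.add_zero, op116_zero_zero_apply]
      exact h
    | succ n ihn =>
      intro J ψ hψ
      have ih := ihn J ψ hψ
      have e : J + (n + 1 + 0) = (J + (n + 0)) + 1 := by omega
      rw [e]
      simp only [op116_succ_left_apply]
      exact step_state hδ₁ hδ₁1 hCst h210B h210AB hmsq ha hk hkK i₀ hs hA hδA hregA hδ₀ hδ₀1 hcv₀ hcd₀ x' (J + (n + 0)) _ ih.1 ih.2 B (Or.inl rfl)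
  | succ n' ih =>
    intro n J ψ hψ
    -- one more factor on the right: the source becomes V_k G_k(T,B)ψ, in the state J + 1 through both propagators
    have hB := hψ B (Or.inl rfl)
    have hψ' : ∀ X : HiggsLattice.VecField P 0, (X = B ∨ X = A + B) →
        (∀ y, ‖propagatorK C Finset.univ X msq a k (srcV C A B k Finset.univ a (propagatorK C Finset.univ B msq a k ψ)) y‖
            ≤ maj P k (cvAt P N C k a Cst s δA δ₀ cv₀ cd₀ (J + 1)) (2 + ((J + 1 : ℕ) : ℝ)) (rateAt P N C k a Cst s δA δ₀ cv₀ cd₀ (J + 1)) y x') ∧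
        (∀ b₀, ‖covDeriv C B (propagatorK C Finset.univ X msq a k
            (srcV C A B k Finset.univ a (propagatorK C Finset.univ B msq a k ψ))) b₀‖
            ≤ maj P k (cdAt P N C k a Cst s δA δ₀ cv₀ cd₀ (J + 1)) (1 + ((J + 1 : ℕ) : ℝ)) (rateAt P N C k a Cst s δA δ₀ cv₀ cd₀ (J + 1)) b₀.src x') :=
      fun X hX => step_state hδ₁ hδ₁1 hCst h210B h210AB hmsq ha hk hkK i₀ hs hA hδA hregA hδ₀ hδ₀1 hcv₀ hcd₀ x' J _ hB.1 hB.2 X hX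
    have h := ih n (J + 1) _ hψ'
    have e : J + (n + (n' + 1)) = J + 1 + (n + n') := by omega
    rw [e]
    simp only [op116_succ_right_apply]
    exact h

end Induction

/-! ## §3b The unit sources: the state of `(1.16)_{n,n′}e_{(x′,i′)}` -/

section UnitSource

variable {C : ChargeData N} {A B : HiggsLattice.VecField P 0} {msq a : ℝ} {k K₀ : ℕ} {hL1 : 1 < P.L} {δ₁ Cst s δA : ℝ}

variable (hδ₁ : 0 < δ₁) (hδ₁1 : δ₁ ≤ 1) (hCst : 0 ≤ Cst)
  (h210B : (regRegionKernels hL1 C Finset.univ B msq a k K₀).Ineq210 δ₁ Cst)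
  (h210AB : (regRegionKernels hL1 C Finset.univ (A + B) msq a k K₀).Ineq210 δ₁ Cst)
  (hmsq : 0 < msq) (ha : 0 < a) (hk : 1 ≤ k) (hkK : k ≤ P.K) (i₀ : Ix N)
  (hs : 0 ≤ s) (hA : ∀ b : HiggsLattice.PBond P 0, |A b| ≤ s) (hδA : 0 ≤ δA)
  (hregA : ∀ (z : HiggsLattice.Site P 0) (μ ν : Fin P.d), |A ⟨z.shift ν, μ⟩ - A ⟨z, μ⟩| ≤ δA)
  (x' : HiggsLattice.Site P 0)
include hδ₁ hδ₁1 hCst h210B h210AB hmsq ha hk hkK i₀ hs hA hδA hregA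

omit i₀ hδA hregA in
/-- **THE UNIT SOURCES ARE IN THE STATE 0**: `‖(G_k(T,X)e_{(x′,i′)})(y)‖ ≤ κ_X(y,x′)`, `‖(D^ε_BG_k(T,X)e_{(x′,i′)})(b)‖ ≤ κ^D_{B,X}(b,x′)` and §1.
[cite: Balaban1983Higgs3, (2.10) p.426] -/
theorem base_state (i' : Ix N) (X : HiggsLattice.VecField P 0) (hX : X = B ∨ X = A + B) :
    (∀ y, ‖propagatorK C Finset.univ X msq a k (cb P N 0 (x', i')) y‖
        ≤ maj P k (cvAt P N C k a Cst s δA δ₁ (P.mesh 0 ^ P.d * Cst) (cK1 P C k Cst s) 0) (2 + ((0 : ℕ) : ℝ)) (rateAt P N C k a Cst s δA δ₁ (P.mesh 0 ^ P.d * Cst) (cK1 P C k Cst s) 0) y x') ∧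
    (∀ b₀, ‖covDeriv C B (propagatorK C Finset.univ X msq a k (cb P N 0 (x', i'))) b₀‖
        ≤ maj P k (cdAt P N C k a Cst s δA δ₁ (P.mesh 0 ^ P.d * Cst) (cK1 P C k Cst s) 0) (1 + ((0 : ℕ) : ℝ)) (rateAt P N C k a Cst s δA δ₁ (P.mesh 0 ^ P.d * Cst) (cK1 P C k Cst s) 0) b₀.src x') := by
  obtain ⟨e1, e2, e3⟩ := seqC_zero (P := P) (N := N) (C := C) (k := k) (a := a) (Cst := Cst) (s := s) (δA := δA)
    (δ₀ := δ₁) (cv₀ := P.mesh 0 ^ P.d * Cst) (cd₀ := cK1 P C k Cst s)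
  rw [e1, e2, e3, Nat.cast_zero, add_zero, add_zero]
  constructor
  · intro y
    refine (norm_G_cb_le_col C msq a k X x' y i').trans ?_
    rcases hX with rfl | rfl
    · exact col_le_maj h210B hmsq ha hk hkK y x'
    · exact col_le_maj h210AB hmsq ha hk hkK y x'
  · intro b₀
    refine (norm_covDeriv_G_cb_le_dcol C msq a k B X x' b₀ i').trans ?_
    rcases hX with rfl | rfl
    · exact dcol_B_le_maj h210B hmsq ha hk hkK hCst hs b₀ x'
    · exact dcol_add_le_maj h210AB hmsq ha hk hkK hδ₁ hδ₁1 hCst hs hA b₀ x'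


/-- **THE FIELD `(1.16)_{n,n′}e_{(x′,i′)}` IS IN THE STATE `n + n′`.** [cite: Balaban1983Higgs3, (1.16) p.414, (2.10) p.426] -/
theorem state_op116_cb (n n' : ℕ) (i' : Ix N) :
    (∀ y, ‖op116 C Finset.univ A B msq a k n n' (cb P N 0 (x', i')) y‖
        ≤ maj P k (cvAt P N C k a Cst s δA δ₁ (P.mesh 0 ^ P.d * Cst) (cK1 P C k Cst s) (n + n')) (2 + ((n + n' : ℕ) : ℝ)) (rateAt P N C k a Cst s δA δ₁ (P.mesh 0 ^ P.d * Cst) (cK1 P C k Cst s) (n + n')) y x') ∧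
    (∀ b₀, ‖covDeriv C B (op116 C Finset.univ A B msq a k n n' (cb P N 0 (x', i'))) b₀‖
        ≤ maj P k (cdAt P N C k a Cst s δA δ₁ (P.mesh 0 ^ P.d * Cst) (cK1 P C k Cst s) (n + n')) (1 + ((n + n' : ℕ) : ℝ)) (rateAt P N C k a Cst s δA δ₁ (P.mesh 0 ^ P.d * Cst) (cK1 P C k Cst s) (n + n')) b₀.src x') := by
  have hc : 0 ≤ P.mesh 0 ^ P.d * Cst := mul_nonneg (pow_nonneg (P.mesh_pos 0).le _) hCst
  obtain ⟨-, hcK1⟩ := cK1_ge (P := P) (C := C) (k := k) hCst hs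
  have h := state_op116 hδ₁ hδ₁1 hCst h210B h210AB hmsq ha hk hkK i₀ hs hA hδA hregA hδ₁ le_rfl hc hcK1 x' n' n 0 (cb P N 0 (x', i'))
    (fun X hX => base_state hδ₁ hδ₁1 hCst h210B h210AB hmsq ha hk hkK hs hA x' i' X hX)
  simp only [Nat.zero_add] at h
  exact h

end UnitSource

/-! ## §4 The theorems: the kernel of (1.16) and its row derivative, uniformly bounded and decaying, for `n + n′` large -/

section Kernel

/-- the value constant of `kernel116_value_le`: `ε^{−d}·N·cvAt(M)/(L^{M+2−d} − 1)` (`N = #Ix`). [cite: Balaban1983Higgs3, (1.16) p.414] -/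
def valC (P : HiggsLattice.Params) (N : ℕ) (C : ChargeData N) (k : ℕ) (a δ₁ Cst s δA : ℝ) (M : ℕ) : ℝ :=
  (P.mesh 0 ^ P.d)⁻¹ * (Fintype.card (Ix N) : ℝ) * (cvAt P N C k a Cst s δA δ₁ (P.mesh 0 ^ P.d * Cst) (cK1 P C k Cst s) M / ((P.L : ℝ) ^ ((2 : ℝ) + (M : ℝ) - (P.d : ℝ)) - 1))

/-- the derivative constant of `kernel116_deriv_le`: `ε^{−d}·N·cdAt(M)/(L^{M+1−d} − 1)`. [cite: Balaban1983Higgs3, (1.16) p.414] -/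
def derC (P : HiggsLattice.Params) (N : ℕ) (C : ChargeData N) (k : ℕ) (a δ₁ Cst s δA : ℝ) (M : ℕ) : ℝ :=
  (P.mesh 0 ^ P.d)⁻¹ * (Fintype.card (Ix N) : ℝ) * (cdAt P N C k a Cst s δA δ₁ (P.mesh 0 ^ P.d * Cst) (cK1 P C k Cst s) M / ((P.L : ℝ) ^ ((1 : ℝ) + (M : ℝ) - (P.d : ℝ)) - 1))

variable {C : ChargeData N} {A B : HiggsLattice.VecField P 0} {msq a : ℝ} {k K₀ : ℕ} {hL1 : 1 < P.L} {δ₁ Cst s δA : ℝ}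

/-- scale algebra: `(L^kε)^{e+M−d} = (L^kε)^M·((L^kε)^e·((L^kε)^d)^{−1})` (`e` a natural number). [cite: Balaban1983Higgs3, (2.10) p.426] -/
theorem mesh_rpow_split (e M : ℕ) :
    P.mesh k ^ ((e : ℝ) + (M : ℝ) - (P.d : ℝ)) = P.mesh k ^ M * (P.mesh k ^ e * (P.mesh k ^ P.d)⁻¹) := by
  have hm : 0 < P.mesh k := P.mesh_pos k
  rw [Real.rpow_sub hm, show (e : ℝ) + (M : ℝ) = ((e + M : ℕ) : ℝ) by push_cast; ring, Real.rpow_natCast, Real.rpow_natCast,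
    pow_add, div_eq_mul_inv]
  ring

/-- `(L^kε)^{2+M−d} = (L^kε)^M·((L^kε)²((L^kε)^d)^{−1})`. [cite: Balaban1983Higgs3, (2.10) p.426] -/
theorem mesh_rpow_split_two (M : ℕ) :
    P.mesh k ^ ((2 : ℝ) + (M : ℝ) - (P.d : ℝ)) = P.mesh k ^ M * (P.mesh k ^ 2 * (P.mesh k ^ P.d)⁻¹) := by
  have h := mesh_rpow_split (P := P) (k := k) 2 M
  simp only [Nat.cast_ofNat] at h
  exact h

/-- `(L^kε)^{1+M−d} = (L^kε)^M·((L^kε)((L^kε)^d)^{−1})`. [cite: Balaban1983Higgs3, (2.10) p.426] -/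
theorem mesh_rpow_split_one (M : ℕ) :
    P.mesh k ^ ((1 : ℝ) + (M : ℝ) - (P.d : ℝ)) = P.mesh k ^ M * (P.mesh k * (P.mesh k ^ P.d)⁻¹) := by
  have h := mesh_rpow_split (P := P) (k := k) 1 M
  simp only [Nat.cast_one, pow_one] at h
  exact h

/-- the decay factor in p40's shape: `δ(L^kε)^{−1}ε|x−x′| = δ·(|x−x′|/L^k)`. [cite: Balaban1983Higgs3, (2.10) p.426] -/
theorem rate_div_eq (δ : ℝ) (x x' : HiggsLattice.Site P 0) :
    δ * (P.mesh k)⁻¹ * (P.mesh 0 * (HiggsLattice.Site.tdist x x' : ℝ)) = δ * ((HiggsLattice.Site.tdist x x' : ℝ) / (P.L : ℝ) ^ k) := by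
  rw [B3Op116ScaleChains.rate_eq]
  ring

variable (hδ₁ : 0 < δ₁) (hδ₁1 : δ₁ ≤ 1) (hCst : 0 ≤ Cst)
  (h210B : (regRegionKernels hL1 C Finset.univ B msq a k K₀).Ineq210 δ₁ Cst)
  (h210AB : (regRegionKernels hL1 C Finset.univ (A + B) msq a k K₀).Ineq210 δ₁ Cst)
  (hmsq : 0 < msq) (ha : 0 < a) (hk : 1 ≤ k) (hkK : k ≤ P.K) (i₀ : Ix N)
  (hs : 0 ≤ s) (hA : ∀ b : HiggsLattice.PBond P 0, |A b| ≤ s) (hδA : 0 ≤ δA)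
  (hregA : ∀ (z : HiggsLattice.Site P 0) (μ ν : Fin P.d), |A ⟨z.shift ν, μ⟩ - A ⟨z, μ⟩| ≤ δA)
include hδ₁ hδ₁1 hCst h210B h210AB hmsq ha hk hkK i₀ hs hA hδA hregA

/-- **THE KERNEL OF (1.16) IS UNIFORMLY BOUNDED AND EXPONENTIALLY DECAYING ON THE TORUS, FOR ALL `n + n′ + 2 > d`** (print's
*"uniformly bounded … exponentially decaying with the distance of the arguments"* for the VALUE of the kernel, p. 414): on `Ω = T_ε`,
for `m² > 0`, `a > 0`, `1 ≤ k ≤ K`, the (2.10) bounds `Ineq210 δ₁ C` of `G_k(T,B)` and `G_k(T,A+B)`, `sup_b|A_b| ≤ s`, `A` regular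
with `δ_A`, and every `n, n′` with `d < n + n′ + 2`, every `x, x′`:
`ε^{−d}Σ_{i′}‖((1.16)_{n,n′}e_{(x′,i′)})(x)‖ ≤ valC(n+n′)·(L^kε)^{n+n′}·((L^kε)²((L^kε)^d)^{−1})·exp(−δ_{n+n′}|x−x′|/L^k)` — p40's binder `hV`
of `ineq25At_op116_smooth_torus_of_bounds` with the explicit constant `valC` (§3) in place of `C_V·(e_Rp_R)^{n+n′}`.
[cite: Balaban1983Higgs3, (1.16) p.414, (2.5) p.424, (2.10) p.426] [cite: Balaban1982Higgs1, (3.16) p.615] -/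
theorem kernel116_value_le (n n' : ℕ) (hd : (P.d : ℝ) < (n + n' : ℕ) + 2) (x x' : HiggsLattice.Site P 0) :
    (P.mesh 0 ^ P.d)⁻¹ * ∑ i' : Ix N, ‖op116 C Finset.univ A B msq a k n n' (cb P N 0 (x', i')) x‖
      ≤ valC P N C k a δ₁ Cst s δA (n + n') * P.mesh k ^ (n + n') * (P.mesh k ^ 2 * (P.mesh k ^ P.d)⁻¹) *
          Real.exp (-(rateAt P N C k a Cst s δA δ₁ (P.mesh 0 ^ P.d * Cst) (cK1 P C k Cst s) (n + n') * ((HiggsLattice.Site.tdist x x' : ℝ) / (P.L : ℝ) ^ k))) := by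
  have hL : 1 < P.L := hL1
  set M := n + n' with hM
  have hc : 0 ≤ P.mesh 0 ^ P.d * Cst := mul_nonneg (pow_nonneg (P.mesh_pos 0).le _) hCst
  obtain ⟨-, hcK1⟩ := cK1_ge (P := P) (C := C) (k := k) hCst hs
  obtain ⟨hr0, -, hcv0, -⟩ := seqC_pos (P := P) (N := N) (C := C) (k := k) (a := a) (Cst := Cst) (s := s) (δA := δA)
    (δ₀ := δ₁) (cv₀ := P.mesh 0 ^ P.d * Cst) (cd₀ := cK1 P C k Cst s) hL hδ₁ le_rfl hc hcK1 hCst hs hδA M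
  have hsM : 0 < (2 : ℝ) + (M : ℝ) - (P.d : ℝ) := by linarith
  have hε : 0 ≤ (P.mesh 0 ^ P.d)⁻¹ := inv_nonneg.mpr (pow_nonneg (P.mesh_pos 0).le _)
  -- each i′: the state M and the top-scale domination
  have hpt : ∀ i' : Ix N, ‖op116 C Finset.univ A B msq a k n n' (cb P N 0 (x', i')) x‖
      ≤ cvAt P N C k a Cst s δA δ₁ (P.mesh 0 ^ P.d * Cst) (cK1 P C k Cst s) M / ((P.L : ℝ) ^ ((2 : ℝ) + (M : ℝ) - (P.d : ℝ)) - 1) * P.mesh k ^ ((2 : ℝ) + (M : ℝ) - (P.d : ℝ)) *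
          Real.exp (-(rateAt P N C k a Cst s δA δ₁ (P.mesh 0 ^ P.d * Cst) (cK1 P C k Cst s) M * (P.mesh k)⁻¹ * (P.mesh 0 * (HiggsLattice.Site.tdist x x' : ℝ)))) := by
    intro i'
    have h := (state_op116_cb hδ₁ hδ₁1 hCst h210B h210AB hmsq ha hk hkK i₀ hs hA hδA hregA x' n n' i').1 x
    refine h.trans ?_
    unfold maj
    exact majorant_le_top hL hcv0 hsM hr0.le x x'
  calc (P.mesh 0 ^ P.d)⁻¹ * ∑ i' : Ix N, ‖op116 C Finset.univ A B msq a k n n' (cb P N 0 (x', i')) x‖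
      ≤ (P.mesh 0 ^ P.d)⁻¹ * ∑ _i' : Ix N,
          cvAt P N C k a Cst s δA δ₁ (P.mesh 0 ^ P.d * Cst) (cK1 P C k Cst s) M / ((P.L : ℝ) ^ ((2 : ℝ) + (M : ℝ) - (P.d : ℝ)) - 1) * P.mesh k ^ ((2 : ℝ) + (M : ℝ) - (P.d : ℝ)) *
            Real.exp (-(rateAt P N C k a Cst s δA δ₁ (P.mesh 0 ^ P.d * Cst) (cK1 P C k Cst s) M * (P.mesh k)⁻¹ * (P.mesh 0 * (HiggsLattice.Site.tdist x x' : ℝ)))) :=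
        mul_le_mul_of_nonneg_left (Finset.sum_le_sum fun i' _ => hpt i') hε
    _ = _ := by
        rw [Finset.sum_const, Finset.card_univ, nsmul_eq_mul, mesh_rpow_split_two, rate_div_eq, valC]
        ring

/-- **THE ROW DERIVATIVE OF THE KERNEL OF (1.16) IS UNIFORMLY BOUNDED AND EXPONENTIALLY DECAYING ON THE TORUS, FOR ALL `n + n′ + 1 > d`**
(print's sentence for the first covariant derivative in the row variable, p. 414; the regime *"n, n′ sufficiently large"* = honest order
counting: `n + n′ ≥ 3` in `d = 3`): under the hypotheses of `kernel116_value_le`, for every `n, n′` with `d < n + n′ + 1`, every bond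
`⟨x, x+εe_μ⟩` and site `x′`:
`ε^{−d}Σ_{i′}‖(D^ε_B(1.16)_{n,n′}e_{(x′,i′)})(⟨x,μ⟩)‖ ≤ derC(n+n′)·(L^kε)^{n+n′}·((L^kε)((L^kε)^d)^{−1})·exp(−δ_{n+n′}|x−x′|/L^k)` — p40's binder
`hDv` with the explicit constant `derC` (§3).  No `D G D^*` kernel, no `L²` step, no logarithm of `k`: FILE 4α's Leibniz rows make every
factor a column or a differentiated column. [cite: Balaban1983Higgs3, (1.16) p.414, (2.5) p.424, (2.10) p.426] [cite: Balaban1982Higgs1, (3.16) p.615] -/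
theorem kernel116_deriv_le (n n' : ℕ) (hd : (P.d : ℝ) < (n + n' : ℕ) + 1) (μ : Fin P.d) (x x' : HiggsLattice.Site P 0) :
    (P.mesh 0 ^ P.d)⁻¹ * ∑ i' : Ix N, ‖covDeriv C B (op116 C Finset.univ A B msq a k n n' (cb P N 0 (x', i'))) ⟨x, μ⟩‖
      ≤ derC P N C k a δ₁ Cst s δA (n + n') * P.mesh k ^ (n + n') * (P.mesh k * (P.mesh k ^ P.d)⁻¹) *
          Real.exp (-(rateAt P N C k a Cst s δA δ₁ (P.mesh 0 ^ P.d * Cst) (cK1 P C k Cst s) (n + n') * ((HiggsLattice.Site.tdist x x' : ℝ) / (P.L : ℝ) ^ k))) := by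
  have hL : 1 < P.L := hL1
  set M := n + n' with hM
  have hc : 0 ≤ P.mesh 0 ^ P.d * Cst := mul_nonneg (pow_nonneg (P.mesh_pos 0).le _) hCst
  obtain ⟨-, hcK1⟩ := cK1_ge (P := P) (C := C) (k := k) hCst hs
  obtain ⟨hr0, -, -, hcd0⟩ := seqC_pos (P := P) (N := N) (C := C) (k := k) (a := a) (Cst := Cst) (s := s) (δA := δA)
    (δ₀ := δ₁) (cv₀ := P.mesh 0 ^ P.d * Cst) (cd₀ := cK1 P C k Cst s) hL hδ₁ le_rfl hc hcK1 hCst hs hδA M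
  have hsM : 0 < (1 : ℝ) + (M : ℝ) - (P.d : ℝ) := by linarith
  have hε : 0 ≤ (P.mesh 0 ^ P.d)⁻¹ := inv_nonneg.mpr (pow_nonneg (P.mesh_pos 0).le _)
  have hsrc : (⟨x, μ⟩ : HiggsLattice.PBond P 0).src = x := rfl
  have hpt : ∀ i' : Ix N, ‖covDeriv C B (op116 C Finset.univ A B msq a k n n' (cb P N 0 (x', i'))) ⟨x, μ⟩‖
      ≤ cdAt P N C k a Cst s δA δ₁ (P.mesh 0 ^ P.d * Cst) (cK1 P C k Cst s) M / ((P.L : ℝ) ^ ((1 : ℝ) + (M : ℝ) - (P.d : ℝ)) - 1) * P.mesh k ^ ((1 : ℝ) + (M : ℝ) - (P.d : ℝ)) *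
          Real.exp (-(rateAt P N C k a Cst s δA δ₁ (P.mesh 0 ^ P.d * Cst) (cK1 P C k Cst s) M * (P.mesh k)⁻¹ * (P.mesh 0 * (HiggsLattice.Site.tdist x x' : ℝ)))) := by
    intro i'
    have h := (state_op116_cb hδ₁ hδ₁1 hCst h210B h210AB hmsq ha hk hkK i₀ hs hA hδA hregA x' n n' i').2 ⟨x, μ⟩
    rw [hsrc] at h
    refine h.trans ?_
    unfold maj
    exact majorant_le_top hL hcd0 hsM hr0.le x x'
  calc (P.mesh 0 ^ P.d)⁻¹ * ∑ i' : Ix N, ‖covDeriv C B (op116 C Finset.univ A B msq a k n n' (cb P N 0 (x', i'))) ⟨x, μ⟩‖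
      ≤ (P.mesh 0 ^ P.d)⁻¹ * ∑ _i' : Ix N,
          cdAt P N C k a Cst s δA δ₁ (P.mesh 0 ^ P.d * Cst) (cK1 P C k Cst s) M / ((P.L : ℝ) ^ ((1 : ℝ) + (M : ℝ) - (P.d : ℝ)) - 1) * P.mesh k ^ ((1 : ℝ) + (M : ℝ) - (P.d : ℝ)) *
            Real.exp (-(rateAt P N C k a Cst s δA δ₁ (P.mesh 0 ^ P.d * Cst) (cK1 P C k Cst s) M * (P.mesh k)⁻¹ * (P.mesh 0 * (HiggsLattice.Site.tdist x x' : ℝ)))) :=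
        mul_le_mul_of_nonneg_left (Finset.sum_le_sum fun i' _ => hpt i') hε
    _ = _ := by
        rw [Finset.sum_const, Finset.card_univ, nsmul_eq_mul, mesh_rpow_split_one, rate_div_eq, derC]
        ring

end Kernel

/-! ## §5 Consumer conveniences (v1.1, append-only): the closed form of the rates and the signs of the constants

For the (2.5) assembly (p40's `B3Ineq25Op116Smooth.ineq25At_op116_smooth_torus_of_bounds`, binders `hCV`/`hCD`/`hδ`):
`δ_M = δ₀/(4L)^M` and `valC(M), derC(M) ≥ 0` above the respective thresholds. -/

section Consumers

variable {C : ChargeData N} {k : ℕ} {a Cst s δA δ₀ cv₀ cd₀ δ₁ : ℝ}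

/-- closed form of the rate recursion `δ_{J+1} = δ_J/(4L)`: `δ_M = δ₀/(4L)^M`. [cite: Balaban1983Higgs3, (2.10) p.426] -/
theorem rateAt_closed (M : ℕ) :
    rateAt P N C k a Cst s δA δ₀ cv₀ cd₀ M = δ₀ / (4 * (P.L : ℝ)) ^ M := by
  induction M with
  | zero =>
    rw [(seqC_zero (P := P) (N := N) (C := C) (k := k) (a := a) (Cst := Cst) (s := s) (δA := δA) (δ₀ := δ₀)
      (cv₀ := cv₀) (cd₀ := cd₀)).1, pow_zero, div_one]
  | succ M ih =>
    rw [(seqC_succ (P := P) (N := N) (C := C) (k := k) (a := a) (Cst := Cst) (s := s) (δA := δA) (δ₀ := δ₀)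
      (cv₀ := cv₀) (cd₀ := cd₀) M).1, ih, pow_succ]
    have hL : (P.L : ℝ) ≠ 0 := by have := P.hL; positivity
    field_simp
    ring

/-- `0 < δ_M ≤ δ₀`. [cite: Balaban1983Higgs3, (2.10) p.426] -/
theorem rateAt_pos_le (hδ₀ : 0 < δ₀) (M : ℕ) :
    0 < rateAt P N C k a Cst s δA δ₀ cv₀ cd₀ M ∧ rateAt P N C k a Cst s δA δ₀ cv₀ cd₀ M ≤ δ₀ := by
  rw [rateAt_closed]
  have hL1 : (1 : ℝ) ≤ (P.L : ℝ) := by exact_mod_cast P.hL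
  have h4L : (1 : ℝ) ≤ (4 * (P.L : ℝ)) ^ M := one_le_pow₀ (by linarith)
  refine ⟨div_pos hδ₀ (by linarith), ?_⟩
  rw [div_le_iff₀ (by linarith)]
  nlinarith

/-- `valC(M) ≥ 0` above the value threshold `d < M + 2`. [cite: Balaban1983Higgs3, (1.16) p.414] -/
theorem valC_nonneg (hL : 1 < P.L) (hδ₁ : 0 < δ₁) (hCst : 0 ≤ Cst) (hs : 0 ≤ s) (hδA : 0 ≤ δA) (M : ℕ)
    (hd : (P.d : ℝ) < (M : ℝ) + 2) : 0 ≤ valC P N C k a δ₁ Cst s δA M := by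
  have hc : 0 ≤ P.mesh 0 ^ P.d * Cst := mul_nonneg (pow_nonneg (P.mesh_pos 0).le _) hCst
  obtain ⟨-, hcK1⟩ := cK1_ge (P := P) (C := C) (k := k) hCst hs
  obtain ⟨-, -, hcv, -⟩ := seqC_pos (P := P) (N := N) (C := C) (k := k) (a := a) (Cst := Cst) (s := s) (δA := δA)
    (δ₀ := δ₁) (cv₀ := P.mesh 0 ^ P.d * Cst) (cd₀ := cK1 P C k Cst s) hL hδ₁ le_rfl hc hcK1 hCst hs hδA M
  have hL1 : (1 : ℝ) < (P.L : ℝ) := by exact_mod_cast hL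
  have hpow : 1 < (P.L : ℝ) ^ ((2 : ℝ) + (M : ℝ) - (P.d : ℝ)) := Real.one_lt_rpow hL1 (by linarith)
  have hε : 0 ≤ (P.mesh 0 ^ P.d)⁻¹ := inv_nonneg.mpr (pow_nonneg (P.mesh_pos 0).le _)
  unfold valC
  exact mul_nonneg (mul_nonneg hε (Nat.cast_nonneg _)) (div_nonneg hcv (by linarith))

/-- `derC(M) ≥ 0` above the derivative threshold `d < M + 1`. [cite: Balaban1983Higgs3, (1.16) p.414] -/
theorem derC_nonneg (hL : 1 < P.L) (hδ₁ : 0 < δ₁) (hCst : 0 ≤ Cst) (hs : 0 ≤ s) (hδA : 0 ≤ δA) (M : ℕ)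
    (hd : (P.d : ℝ) < (M : ℝ) + 1) : 0 ≤ derC P N C k a δ₁ Cst s δA M := by
  have hc : 0 ≤ P.mesh 0 ^ P.d * Cst := mul_nonneg (pow_nonneg (P.mesh_pos 0).le _) hCst
  obtain ⟨-, hcK1⟩ := cK1_ge (P := P) (C := C) (k := k) hCst hs
  obtain ⟨-, -, -, hcd⟩ := seqC_pos (P := P) (N := N) (C := C) (k := k) (a := a) (Cst := Cst) (s := s) (δA := δA)
    (δ₀ := δ₁) (cv₀ := P.mesh 0 ^ P.d * Cst) (cd₀ := cK1 P C k Cst s) hL hδ₁ le_rfl hc hcK1 hCst hs hδA M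
  have hL1 : (1 : ℝ) < (P.L : ℝ) := by exact_mod_cast hL
  have hpow : 1 < (P.L : ℝ) ^ ((1 : ℝ) + (M : ℝ) - (P.d : ℝ)) := Real.one_lt_rpow hL1 (by linarith)
  have hε : 0 ≤ (P.mesh 0 ^ P.d)⁻¹ := inv_nonneg.mpr (pow_nonneg (P.mesh_pos 0).le _)
  unfold derC
  exact mul_nonneg (mul_nonneg hε (Nat.cast_nonneg _)) (div_nonneg hcd (by linarith))

end Consumers

/-! ## §6 Entry points for DIPOLE seeds (v1.2, append-only; for FILE 4M's `mixed_seed_state`)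

`state_op116` asks for BOTH images `G_k(T,B)ψ`, `G_k(T,A+B)ψ` of the source in the state `J`; a dipole source `ψ = dip^B_{b′}Y` has
neither (its `D^ε_B`-row has exponent `0`), but `V_kG_k(T,B)ψ` does after FILE 4M's Calderón–Zygmund step.  By r14's recursion
`(1.16)_{n,n′+1}ψ = (1.16)_{n,n′}(V_kG_k(T,B)ψ)`, `(1.16)_{n,0}ψ = [G_k(T,B)V_k]^nG_k(T,A+B)ψ`, the induction needs exactly:
`n′ = 0`: `G_k(T,A+B)ψ` in a state (`state_op116_zero_right`); `n′ = 1`: `G_k(T,A+B)V_kG_k(T,B)ψ = Wψ` in a state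
(`state_op116_one_right` — FILE 4M's `mixed_seed_state`); `n′ ≥ 2`: both `G_k(T,X)V_kG_k(T,B)ψ`, `X ∈ {B, A+B}`, in a state
(`state_op116_succ_right`).  Generic seed triple `(δ₀, cv₀, cd₀)` throughout. -/

section DipoleEntry

variable {C : ChargeData N} {A B : HiggsLattice.VecField P 0} {msq a : ℝ} {k K₀ : ℕ} {hL1 : 1 < P.L} {δ₁ Cst s δA δ₀ cv₀ cd₀ : ℝ}

variable (hδ₁ : 0 < δ₁) (hδ₁1 : δ₁ ≤ 1) (hCst : 0 ≤ Cst)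
  (h210B : (regRegionKernels hL1 C Finset.univ B msq a k K₀).Ineq210 δ₁ Cst)
  (h210AB : (regRegionKernels hL1 C Finset.univ (A + B) msq a k K₀).Ineq210 δ₁ Cst)
  (hmsq : 0 < msq) (ha : 0 < a) (hk : 1 ≤ k) (hkK : k ≤ P.K) (i₀ : Ix N)
  (hs : 0 ≤ s) (hA : ∀ b : HiggsLattice.PBond P 0, |A b| ≤ s) (hδA : 0 ≤ δA)
  (hregA : ∀ (z : HiggsLattice.Site P 0) (μ ν : Fin P.d), |A ⟨z.shift ν, μ⟩ - A ⟨z, μ⟩| ≤ δA)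
  (hδ₀ : 0 < δ₀) (hδ₀1 : δ₀ ≤ δ₁) (hcv₀ : 0 ≤ cv₀) (hcd₀ : 0 ≤ cd₀)
  (x' : HiggsLattice.Site P 0)
include hδ₁ hδ₁1 hCst h210B h210AB hmsq ha hk hkK i₀ hs hA hδA hregA hδ₀ hδ₀1 hcv₀ hcd₀

/-- `n′ = 0`: if `G_k(T,A+B)ψ` is in the state `J`, then `(1.16)_{n,0}ψ = [G_k(T,B)V_k]^nG_k(T,A+B)ψ` is in the state `J + n`
(only `X = B` steps; the `G_k(T,B)`-image of `ψ` is not needed). [cite: Balaban1983Higgs3, (1.16) p.414, (2.10) p.426] -/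
theorem state_op116_zero_right : ∀ (n J : ℕ) (ψ : ScalarField P 0 N),
    ((∀ y, ‖propagatorK C Finset.univ (A + B) msq a k ψ y‖
          ≤ maj P k (cvAt P N C k a Cst s δA δ₀ cv₀ cd₀ J) (2 + ((J : ℕ) : ℝ)) (rateAt P N C k a Cst s δA δ₀ cv₀ cd₀ J) y x') ∧
      (∀ b₀, ‖covDeriv C B (propagatorK C Finset.univ (A + B) msq a k ψ) b₀‖
          ≤ maj P k (cdAt P N C k a Cst s δA δ₀ cv₀ cd₀ J) (1 + ((J : ℕ) : ℝ)) (rateAt P N C k a Cst s δA δ₀ cv₀ cd₀ J) b₀.src x')) →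
    (∀ y, ‖op116 C Finset.univ A B msq a k n 0 ψ y‖
          ≤ maj P k (cvAt P N C k a Cst s δA δ₀ cv₀ cd₀ (J + n)) (2 + (((J + n) : ℕ) : ℝ)) (rateAt P N C k a Cst s δA δ₀ cv₀ cd₀ (J + n)) y x') ∧
      (∀ b₀, ‖covDeriv C B (op116 C Finset.univ A B msq a k n 0 ψ) b₀‖
          ≤ maj P k (cdAt P N C k a Cst s δA δ₀ cv₀ cd₀ (J + n)) (1 + (((J + n) : ℕ) : ℝ)) (rateAt P N C k a Cst s δA δ₀ cv₀ cd₀ (J + n)) b₀.src x') := by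
  intro n
  induction n with
  | zero =>
    intro J ψ hψ
    simp only [Nat.add_zero, op116_zero_zero_apply]
    exact hψ
  | succ n ihn =>
    intro J ψ hψ
    have ih := ihn J ψ hψ
    have e : J + (n + 1) = (J + n) + 1 := by omega
    rw [e]
    simp only [op116_succ_left_apply]
    exact step_state hδ₁ hδ₁1 hCst h210B h210AB hmsq ha hk hkK i₀ hs hA hδA hregA hδ₀ hδ₀1 hcv₀ hcd₀ x' (J + n) _ ih.1 ih.2 B
      (Or.inl rfl)

/-- `n′ = 1`: if `Wψ := G_k(T,A+B)V_kG_k(T,B)ψ` is in the state `J` (FILE 4M's `mixed_seed_state` for `ψ = dip^B_{b′}Y`, `J = 0`),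
then `(1.16)_{n,1}ψ` is in the state `J + n`. [cite: Balaban1983Higgs3, (1.16) p.414, (2.10) p.426] -/
theorem state_op116_one_right (n J : ℕ) (ψ : ScalarField P 0 N)
    (hW : (∀ y, ‖propagatorK C Finset.univ (A + B) msq a k (srcV C A B k Finset.univ a (propagatorK C Finset.univ B msq a k ψ)) y‖
          ≤ maj P k (cvAt P N C k a Cst s δA δ₀ cv₀ cd₀ J) (2 + ((J : ℕ) : ℝ)) (rateAt P N C k a Cst s δA δ₀ cv₀ cd₀ J) y x') ∧
      (∀ b₀, ‖covDeriv C B (propagatorK C Finset.univ (A + B) msq a k (srcV C A B k Finset.univ a (propagatorK C Finset.univ B msq a k ψ))) b₀‖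
          ≤ maj P k (cdAt P N C k a Cst s δA δ₀ cv₀ cd₀ J) (1 + ((J : ℕ) : ℝ)) (rateAt P N C k a Cst s δA δ₀ cv₀ cd₀ J) b₀.src x')) :
    (∀ y, ‖op116 C Finset.univ A B msq a k n 1 ψ y‖
          ≤ maj P k (cvAt P N C k a Cst s δA δ₀ cv₀ cd₀ (J + n)) (2 + (((J + n) : ℕ) : ℝ)) (rateAt P N C k a Cst s δA δ₀ cv₀ cd₀ (J + n)) y x') ∧
      (∀ b₀, ‖covDeriv C B (op116 C Finset.univ A B msq a k n 1 ψ) b₀‖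
          ≤ maj P k (cdAt P N C k a Cst s δA δ₀ cv₀ cd₀ (J + n)) (1 + (((J + n) : ℕ) : ℝ)) (rateAt P N C k a Cst s δA δ₀ cv₀ cd₀ (J + n)) b₀.src x') := by
  have h := state_op116_zero_right hδ₁ hδ₁1 hCst h210B h210AB hmsq ha hk hkK i₀ hs hA hδA hregA hδ₀ hδ₀1 hcv₀ hcd₀ x' n J _ hW
  simp only [op116_succ_right_apply]
  exact h

/-- `n′ ≥ 2` (and every `n′ ≥ 1`): if both `G_k(T,X)V_kG_k(T,B)ψ`, `X ∈ {B, A+B}`, are in the state `J`, then `(1.16)_{n,n′+1}ψ` is in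
the state `J + (n + n′)` (`state_op116` for the source `V_kG_k(T,B)ψ`). [cite: Balaban1983Higgs3, (1.16) p.414, (2.10) p.426] -/
theorem state_op116_succ_right (n' n J : ℕ) (ψ : ScalarField P 0 N)
    (hVG : ∀ X : HiggsLattice.VecField P 0, (X = B ∨ X = A + B) →
      (∀ y, ‖propagatorK C Finset.univ X msq a k (srcV C A B k Finset.univ a (propagatorK C Finset.univ B msq a k ψ)) y‖
          ≤ maj P k (cvAt P N C k a Cst s δA δ₀ cv₀ cd₀ J) (2 + ((J : ℕ) : ℝ)) (rateAt P N C k a Cst s δA δ₀ cv₀ cd₀ J) y x') ∧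
      (∀ b₀, ‖covDeriv C B (propagatorK C Finset.univ X msq a k (srcV C A B k Finset.univ a (propagatorK C Finset.univ B msq a k ψ))) b₀‖
          ≤ maj P k (cdAt P N C k a Cst s δA δ₀ cv₀ cd₀ J) (1 + ((J : ℕ) : ℝ)) (rateAt P N C k a Cst s δA δ₀ cv₀ cd₀ J) b₀.src x')) :
    (∀ y, ‖op116 C Finset.univ A B msq a k n (n' + 1) ψ y‖
          ≤ maj P k (cvAt P N C k a Cst s δA δ₀ cv₀ cd₀ (J + (n + n'))) (2 + (((J + (n + n')) : ℕ) : ℝ)) (rateAt P N C k a Cst s δA δ₀ cv₀ cd₀ (J + (n + n'))) y x') ∧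
      (∀ b₀, ‖covDeriv C B (op116 C Finset.univ A B msq a k n (n' + 1) ψ) b₀‖
          ≤ maj P k (cdAt P N C k a Cst s δA δ₀ cv₀ cd₀ (J + (n + n'))) (1 + (((J + (n + n')) : ℕ) : ℝ)) (rateAt P N C k a Cst s δA δ₀ cv₀ cd₀ (J + (n + n'))) b₀.src x') := by
  have h := state_op116 hδ₁ hδ₁1 hCst h210B h210AB hmsq ha hk hkK i₀ hs hA hδA hregA hδ₀ hδ₀1 hcv₀ hcd₀ x' n' n J _ hVG
  simp only [op116_succ_right_apply]
  exact h

/-- LEFT ITERATION from any starting point: if `(1.16)_{n₀,n′}ψ` is in the state `J`, then `(1.16)_{n₀+m,n′}ψ = [G_k(T,B)V_k]^m(1.16)_{n₀,n′}ψ`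
is in the state `J + m` (`m` steps `X = B`).  For the dipole seed with `n′ = 0`: `(1.16)_{1,0}dip = G_k(T,B)V_kG_k(T,A+B)dip = W dip` in the
state `0` (FILE 4M) ⇒ `(1.16)_{1+m,0}dip` in the state `m`. [cite: Balaban1983Higgs3, (1.16) p.414, (2.10) p.426] -/
theorem state_op116_add_left (n₀ n' : ℕ) : ∀ (m J : ℕ) (ψ : ScalarField P 0 N),
    ((∀ y, ‖op116 C Finset.univ A B msq a k n₀ n' ψ y‖
          ≤ maj P k (cvAt P N C k a Cst s δA δ₀ cv₀ cd₀ J) (2 + ((J : ℕ) : ℝ)) (rateAt P N C k a Cst s δA δ₀ cv₀ cd₀ J) y x') ∧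
      (∀ b₀, ‖covDeriv C B (op116 C Finset.univ A B msq a k n₀ n' ψ) b₀‖
          ≤ maj P k (cdAt P N C k a Cst s δA δ₀ cv₀ cd₀ J) (1 + ((J : ℕ) : ℝ)) (rateAt P N C k a Cst s δA δ₀ cv₀ cd₀ J) b₀.src x')) →
    (∀ y, ‖op116 C Finset.univ A B msq a k (n₀ + m) n' ψ y‖
          ≤ maj P k (cvAt P N C k a Cst s δA δ₀ cv₀ cd₀ (J + m)) (2 + (((J + m) : ℕ) : ℝ)) (rateAt P N C k a Cst s δA δ₀ cv₀ cd₀ (J + m)) y x') ∧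
      (∀ b₀, ‖covDeriv C B (op116 C Finset.univ A B msq a k (n₀ + m) n' ψ) b₀‖
          ≤ maj P k (cdAt P N C k a Cst s δA δ₀ cv₀ cd₀ (J + m)) (1 + (((J + m) : ℕ) : ℝ)) (rateAt P N C k a Cst s δA δ₀ cv₀ cd₀ (J + m)) b₀.src x') := by
  intro m
  induction m with
  | zero =>
    intro J ψ hψ
    simp only [Nat.add_zero]
    exact hψ
  | succ m ihm =>
    intro J ψ hψ
    have ih := ihm J ψ hψ
    have e : J + (m + 1) = (J + m) + 1 := by omega
    rw [e, show n₀ + (m + 1) = (n₀ + m) + 1 from rfl]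
    simp only [op116_succ_left_apply]
    exact step_state hδ₁ hδ₁1 hCst h210B h210AB hmsq ha hk hkK i₀ hs hA hδA hregA hδ₀ hδ₀1 hcv₀ hcd₀ x' (J + m) _ ih.1 ih.2 B
      (Or.inl rfl)

end DipoleEntry

/-! ## §7 Glue to FILE 4M's seed (v1.4, append-only): the two readings of `W = G_k(T,A+B) − G_k(T,B)` and the state-`0` entry
points with LITERAL exponents `2`/`1` and rate `δ₀` (the conclusion shape of p40's `B3Op116MixedSeed.mixed_seed_state`)

(I.3.44) read from the right resp. the left (p40's `B3Eq116TwoSidedExpansion.eq344_model_right` / `eq344_model`, r14's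
`opV_apply_eq_srcV`): `Wφ = G_k(T,A+B)V_kG_k(T,B)φ = (1.16)_{0,1}φ` and `Wφ = G_k(T,B)V_kG_k(T,A+B)φ = (1.16)_{1,0}φ`.  Hence a seed
«`W dip` in the state `0`» feeds `state_op116_one_right` (`n′ = 1`), `state_op116_add_left` (`n′ = 0`), and — together with the second
seed «`G_k(T,B)V_kG_k(T,B)dip` in the state `0`» — `state_op116_succ_right` (`n′ ≥ 2`). -/

section SeedGlue

variable {C : ChargeData N} {A B : HiggsLattice.VecField P 0} {msq a : ℝ} {k K₀ : ℕ} {hL1 : 1 < P.L} {δ₁ Cst s δA δ₀ cv₀ cd₀ : ℝ}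

/-- `W = G_k(T,A+B) − G_k(T,B)` read from the RIGHT: `Wφ = G_k(T,A+B)V_k(A,B)G_k(T,B)φ = (1.16)_{0,1}φ` ((I.3.44), `m² > 0`, `a > 0`,
`k ≥ 1`, `L > 1`). [cite: Balaban1982Higgs1, (3.44) p.619] [cite: Balaban1983Higgs3, (1.16) p.414] -/
theorem W_apply_eq_op116_zero_one (hL : 1 < P.L) (hmsq : 0 < msq) (ha : 0 < a) (hk : 1 ≤ k) (φ : ScalarField P 0 N) :
    (propagatorK C Finset.univ (A + B) msq a k - propagatorK C Finset.univ B msq a k) φ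
      = op116 C Finset.univ A B msq a k 0 1 φ := by
  have hL' : (1 : ℝ) < (P.L : ℝ) := by exact_mod_cast hL
  have h344 := B3Eq116TwoSidedExpansion.eq344_model_right C Finset.univ A B a k hmsq (B1.aSeq_pos ha hL' hk).le
  have hW : (propagatorK C Finset.univ (A + B) msq a k - propagatorK C Finset.univ B msq a k)
      = propagatorK C Finset.univ (A + B) msq a k * B3Eq116TwoSidedExpansion.opV C Finset.univ A B msq a k * propagatorK C Finset.univ B msq a k := by
    nth_rewrite 1 [h344]
    abel
  rw [hW, op116_succ_right_apply, op116_zero_zero_apply, Module.End.mul_apply, Module.End.mul_apply, B3Op116SourceForm.opV_apply_eq_srcV]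

/-- `W` read from the LEFT: `Wφ = G_k(T,B)V_k(A,B)G_k(T,A+B)φ = (1.16)_{1,0}φ`. [cite: Balaban1982Higgs1, (3.44) p.619] [cite: Balaban1983Higgs3, (1.16) p.414] -/
theorem W_apply_eq_op116_one_zero (hL : 1 < P.L) (hmsq : 0 < msq) (ha : 0 < a) (hk : 1 ≤ k) (φ : ScalarField P 0 N) :
    (propagatorK C Finset.univ (A + B) msq a k - propagatorK C Finset.univ B msq a k) φ
      = op116 C Finset.univ A B msq a k 1 0 φ := by
  have hL' : (1 : ℝ) < (P.L : ℝ) := by exact_mod_cast hL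
  have h344 := B3Eq116TwoSidedExpansion.eq344_model C Finset.univ A B a k hmsq (B1.aSeq_pos ha hL' hk).le
  have hW : (propagatorK C Finset.univ (A + B) msq a k - propagatorK C Finset.univ B msq a k)
      = propagatorK C Finset.univ B msq a k * B3Eq116TwoSidedExpansion.opV C Finset.univ A B msq a k * propagatorK C Finset.univ (A + B) msq a k := by
    nth_rewrite 1 [h344]
    abel
  rw [hW, op116_succ_left_apply, op116_zero_zero_apply, Module.End.mul_apply, Module.End.mul_apply, B3Op116SourceForm.opV_apply_eq_srcV]

variable (hδ₁ : 0 < δ₁) (hδ₁1 : δ₁ ≤ 1) (hCst : 0 ≤ Cst)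
  (h210B : (regRegionKernels hL1 C Finset.univ B msq a k K₀).Ineq210 δ₁ Cst)
  (h210AB : (regRegionKernels hL1 C Finset.univ (A + B) msq a k K₀).Ineq210 δ₁ Cst)
  (hmsq : 0 < msq) (ha : 0 < a) (hk : 1 ≤ k) (hkK : k ≤ P.K) (i₀ : Ix N)
  (hs : 0 ≤ s) (hA : ∀ b : HiggsLattice.PBond P 0, |A b| ≤ s) (hδA : 0 ≤ δA)
  (hregA : ∀ (z : HiggsLattice.Site P 0) (μ ν : Fin P.d), |A ⟨z.shift ν, μ⟩ - A ⟨z, μ⟩| ≤ δA)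
  (hδ₀ : 0 < δ₀) (hδ₀1 : δ₀ ≤ δ₁) (hcv₀ : 0 ≤ cv₀) (hcd₀ : 0 ≤ cd₀)
  (x' : HiggsLattice.Site P 0)
include hδ₁ hδ₁1 hCst h210B h210AB hmsq ha hk hkK i₀ hs hA hδA hregA hδ₀ hδ₀1 hcv₀ hcd₀

omit hδ₁ hδ₁1 hCst h210B h210AB hmsq ha hk hkK i₀ hs hA hδA hregA hδ₀ hδ₀1 hcv₀ hcd₀ in
/-- the state `0` with literal exponents is the state `0` of the recursion (`seqC_zero`). [cite: Balaban1983Higgs3, (2.10) p.426] -/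
theorem state_zero_iff (φ : ScalarField P 0 N) :
    ((∀ y, ‖φ y‖ ≤ maj P k cv₀ 2 δ₀ y x') ∧
      (∀ b₀, ‖covDeriv C B (φ) b₀‖ ≤ maj P k cd₀ 1 δ₀ b₀.src x')) ↔
    ((∀ y, ‖φ y‖
          ≤ maj P k (cvAt P N C k a Cst s δA δ₀ cv₀ cd₀ 0) (2 + ((0 : ℕ) : ℝ)) (rateAt P N C k a Cst s δA δ₀ cv₀ cd₀ 0) y x') ∧
      (∀ b₀, ‖covDeriv C B (φ) b₀‖
          ≤ maj P k (cdAt P N C k a Cst s δA δ₀ cv₀ cd₀ 0) (1 + ((0 : ℕ) : ℝ)) (rateAt P N C k a Cst s δA δ₀ cv₀ cd₀ 0) b₀.src x')) := by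
  obtain ⟨e1, e2, e3⟩ := seqC_zero (P := P) (N := N) (C := C) (k := k) (a := a) (Cst := Cst) (s := s) (δA := δA) (δ₀ := δ₀)
    (cv₀ := cv₀) (cd₀ := cd₀)
  rw [e1, e2, e3, Nat.cast_zero, add_zero, add_zero]

/-- **`n′ = 1` from the seed**: `W dip` in the state `0` (p40's `mixed_seed_state`, literal exponents) ⇒ `(1.16)_{n,1}dip` in the state
`n`. Stated for any source `ψ` and anchor `x′`. [cite: Balaban1983Higgs3, (1.16) p.414, (2.10) p.426] -/
theorem state_op116_one_right_seed (n : ℕ) (ψ : ScalarField P 0 N)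
    (hW : (∀ y, ‖(propagatorK C Finset.univ (A + B) msq a k - propagatorK C Finset.univ B msq a k) ψ y‖ ≤ maj P k cv₀ 2 δ₀ y x') ∧
      (∀ b₀, ‖covDeriv C B ((propagatorK C Finset.univ (A + B) msq a k - propagatorK C Finset.univ B msq a k) ψ) b₀‖ ≤ maj P k cd₀ 1 δ₀ b₀.src x')) :
    (∀ y, ‖op116 C Finset.univ A B msq a k n 1 ψ y‖
          ≤ maj P k (cvAt P N C k a Cst s δA δ₀ cv₀ cd₀ n) (2 + ((n : ℕ) : ℝ)) (rateAt P N C k a Cst s δA δ₀ cv₀ cd₀ n) y x') ∧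
      (∀ b₀, ‖covDeriv C B (op116 C Finset.univ A B msq a k n 1 ψ) b₀‖
          ≤ maj P k (cdAt P N C k a Cst s δA δ₀ cv₀ cd₀ n) (1 + ((n : ℕ) : ℝ)) (rateAt P N C k a Cst s δA δ₀ cv₀ cd₀ n) b₀.src x') := by
  have hL : 1 < P.L := hL1
  rw [W_apply_eq_op116_zero_one hL hmsq ha hk] at hW
  have hW' := hW
  simp only [op116_succ_right_apply, op116_zero_zero_apply] at hW'
  have h0 := (state_zero_iff (P := P) (N := N) (C := C) (B := B) (a := a) (k := k) (Cst := Cst) (s := s)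
    (δA := δA) (δ₀ := δ₀) (cv₀ := cv₀) (cd₀ := cd₀) x' _).1 hW'
  have h := state_op116_one_right hδ₁ hδ₁1 hCst h210B h210AB hmsq ha hk hkK i₀ hs hA hδA hregA hδ₀ hδ₀1 hcv₀ hcd₀ x' n 0 ψ h0
  simpa only [Nat.zero_add] using h

/-- **`n′ = 0` from the seed**: `W dip` in the state `0` ⇒ `(1.16)_{1+m,0}dip` in the state `m`. [cite: Balaban1983Higgs3, (1.16) p.414, (2.10) p.426] -/
theorem state_op116_add_left_seed (m : ℕ) (ψ : ScalarField P 0 N)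
    (hW : (∀ y, ‖(propagatorK C Finset.univ (A + B) msq a k - propagatorK C Finset.univ B msq a k) ψ y‖ ≤ maj P k cv₀ 2 δ₀ y x') ∧
      (∀ b₀, ‖covDeriv C B ((propagatorK C Finset.univ (A + B) msq a k - propagatorK C Finset.univ B msq a k) ψ) b₀‖ ≤ maj P k cd₀ 1 δ₀ b₀.src x')) :
    (∀ y, ‖op116 C Finset.univ A B msq a k (1 + m) 0 ψ y‖
          ≤ maj P k (cvAt P N C k a Cst s δA δ₀ cv₀ cd₀ m) (2 + ((m : ℕ) : ℝ)) (rateAt P N C k a Cst s δA δ₀ cv₀ cd₀ m) y x') ∧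
      (∀ b₀, ‖covDeriv C B (op116 C Finset.univ A B msq a k (1 + m) 0 ψ) b₀‖
          ≤ maj P k (cdAt P N C k a Cst s δA δ₀ cv₀ cd₀ m) (1 + ((m : ℕ) : ℝ)) (rateAt P N C k a Cst s δA δ₀ cv₀ cd₀ m) b₀.src x') := by
  have hL : 1 < P.L := hL1
  rw [W_apply_eq_op116_one_zero hL hmsq ha hk] at hW
  have h0 := (state_zero_iff (P := P) (N := N) (C := C) (B := B) (a := a) (k := k) (Cst := Cst) (s := s)
    (δA := δA) (δ₀ := δ₀) (cv₀ := cv₀) (cd₀ := cd₀) x' _).1 hW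
  have h := state_op116_add_left hδ₁ hδ₁1 hCst h210B h210AB hmsq ha hk hkK i₀ hs hA hδA hregA hδ₀ hδ₀1 hcv₀ hcd₀ x' 1 0 m 0 ψ h0
  simpa only [Nat.zero_add] using h

/-- **`n′ ≥ 2` from the two seeds**: `W dip = G_k(T,A+B)V_kG_k(T,B)dip` AND `G_k(T,B)V_kG_k(T,B)dip` in the state `0` (literal exponents)
⇒ `(1.16)_{n,n′+1}dip` in the state `n + n′`. [cite: Balaban1983Higgs3, (1.16) p.414, (2.10) p.426] -/
theorem state_op116_succ_right_seed (n' n : ℕ) (ψ : ScalarField P 0 N)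
    (hW : (∀ y, ‖(propagatorK C Finset.univ (A + B) msq a k - propagatorK C Finset.univ B msq a k) ψ y‖ ≤ maj P k cv₀ 2 δ₀ y x') ∧
      (∀ b₀, ‖covDeriv C B ((propagatorK C Finset.univ (A + B) msq a k - propagatorK C Finset.univ B msq a k) ψ) b₀‖ ≤ maj P k cd₀ 1 δ₀ b₀.src x'))
    (hBB : (∀ y, ‖propagatorK C Finset.univ B msq a k (srcV C A B k Finset.univ a (propagatorK C Finset.univ B msq a k ψ)) y‖ ≤ maj P k cv₀ 2 δ₀ y x') ∧
      (∀ b₀, ‖covDeriv C B (propagatorK C Finset.univ B msq a k (srcV C A B k Finset.univ a (propagatorK C Finset.univ B msq a k ψ))) b₀‖ ≤ maj P k cd₀ 1 δ₀ b₀.src x')) :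
    (∀ y, ‖op116 C Finset.univ A B msq a k n (n' + 1) ψ y‖
          ≤ maj P k (cvAt P N C k a Cst s δA δ₀ cv₀ cd₀ (n + n')) (2 + (((n + n') : ℕ) : ℝ)) (rateAt P N C k a Cst s δA δ₀ cv₀ cd₀ (n + n')) y x') ∧
      (∀ b₀, ‖covDeriv C B (op116 C Finset.univ A B msq a k n (n' + 1) ψ) b₀‖
          ≤ maj P k (cdAt P N C k a Cst s δA δ₀ cv₀ cd₀ (n + n')) (1 + (((n + n') : ℕ) : ℝ)) (rateAt P N C k a Cst s δA δ₀ cv₀ cd₀ (n + n')) b₀.src x') := by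
  have hL : 1 < P.L := hL1
  rw [W_apply_eq_op116_zero_one hL hmsq ha hk] at hW
  simp only [op116_succ_right_apply, op116_zero_zero_apply] at hW
  have hVG : ∀ X : HiggsLattice.VecField P 0, (X = B ∨ X = A + B) →
      (∀ y, ‖propagatorK C Finset.univ X msq a k (srcV C A B k Finset.univ a (propagatorK C Finset.univ B msq a k ψ)) y‖
          ≤ maj P k (cvAt P N C k a Cst s δA δ₀ cv₀ cd₀ 0) (2 + ((0 : ℕ) : ℝ)) (rateAt P N C k a Cst s δA δ₀ cv₀ cd₀ 0) y x') ∧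
      (∀ b₀, ‖covDeriv C B (propagatorK C Finset.univ X msq a k (srcV C A B k Finset.univ a (propagatorK C Finset.univ B msq a k ψ))) b₀‖
          ≤ maj P k (cdAt P N C k a Cst s δA δ₀ cv₀ cd₀ 0) (1 + ((0 : ℕ) : ℝ)) (rateAt P N C k a Cst s δA δ₀ cv₀ cd₀ 0) b₀.src x') := by
    intro X hX
    rcases hX with hX | hX <;> rw [hX]
    · exact (state_zero_iff (P := P) (N := N) (C := C) (B := B) (a := a) (k := k) (Cst := Cst) (s := s)
        (δA := δA) (δ₀ := δ₀) (cv₀ := cv₀) (cd₀ := cd₀) x' _).1 hBB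
    · exact (state_zero_iff (P := P) (N := N) (C := C) (B := B) (a := a) (k := k) (Cst := Cst) (s := s)
        (δA := δA) (δ₀ := δ₀) (cv₀ := cv₀) (cd₀ := cd₀) x' _).1 hW
  have h := state_op116_succ_right hδ₁ hδ₁1 hCst h210B h210AB hmsq ha hk hkK i₀ hs hA hδA hregA hδ₀ hδ₀1 hcv₀ hcd₀ x' n' n 0 ψ hVG
  simpa only [Nat.zero_add] using h

end SeedGlue

end Literature.MathematicalPhysics.QuantumFieldTheory.Balaban1983to89.B3Op116DKernelRegularTorus
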